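import Literature.Probability.LatticeModels.GaussianDomination
import Literature.Probability.LatticeModels.InfraredBoundProofs
import Literature.Probability.LatticeModels.IsingTorusTransfer
import Mathlib.Analysis.Matrix.Spectrum
import Mathlib.LinearAlgebra.Matrix.PosDef
import Mathlib.Analysis.SpecialFunctions.Trigonometric.DerivHyp
import HarnessLib

/-!
# The transfer-matrix spectral representation on the torus: `Ĝ_N(p)` is decreasing and `ℰ₁(p_i)Ĝ_N(p)` increasing in each `|p_i|`

Topic `Literature/Probability/LatticeModels`; family `crit-ising` (crit-ising.S11–S13: the two-point
function of the nearest-neighbour Ising model in Fourier space). Theorem-only file: **no named fact, no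
sorry**; the only definitions are concrete finite objects (layers, the transfer matrix, the kernels).

## What is proved

For the nearest-neighbour Ising model on the discrete torus `(ℤ/Nℤ)^{d'+1}` (`isingTorusMeasure`,
periodic boundary condition, `N ≥ 3`, `β ≥ 0`, arbitrary field `h`) and the Fourier transform
`Ĝ_N(k) = ∑_x ⟨σ₀σ_x⟩ e^{-2πi k·x/N}` of its two-point function (`twoPointFourierTorus`, the object of
the infrared bound `infraredBound_holds`):

* `twoPointFourierTorus_re_nonneg` — `Ĝ_N(k) ≥ 0`;
* `twoPointFourierTorus_re_le_of_cos_le` — **(i)** for `k, k'` differing only in the coordinate `i`,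
  `cos(2πk'_i/N) ≤ cos(2πk_i/N)` implies `Ĝ_N(k') ≤ Ĝ_N(k)`: `Ĝ_N` is *decreasing in `|p_i|`*;
* `one_sub_cos_mul_twoPointFourierTorus_re_le` — **(ii)** under the same hypothesis
  `(1 - cos p_i) Ĝ_N(k) ≤ (1 - cos p'_i) Ĝ_N(k')`: `ℰ₁(p_i) Ĝ_N(p)` is *increasing in `|p_i|`*
  (`ℰ₁(p_i) = 2(1 - cos p_i)`);
* `exists_spectralProfile` — the structure theorem behind both: for fixed `i` and transverse momentum
  `k⊥`, `|Λ^{(d')}| Z Ĝ_N(k) = ρ(1 - cos p_i)` where `ρ` is a nonnegative combination of Lorentzians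
  `(λ^N-μ^N)(λ²-μ²)/((λ-μ)² + 2λμ u)` in `u = 1 - cos p_i` and of a point mass at `u = 0`
  (`pairKernel`), `λ, μ ≥ 0` running over pairs of eigenvalues of the transfer matrix.

These are the **exact finite-volume forms** of M. Aizenman, H. Duminil-Copin, *Marginal triviality of
the scaling limits of critical 4D Ising and `φ⁴₄` models*, Ann. of Math. 194 (2021) =
arXiv:1912.07973, **Proposition 5.4, items (i) and (ii)** (p. 18; from the spectral representation
Prop. 5.3, p. 17, proved in their Appendix through the transfer matrix), restated as R. Panis,
arXiv:2309.05797, Thm 3.13 and **Cor. 3.15 (i),(ii)**; item (i) goes back to Glimm–Jaffe (1973).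
The printed statements concern the infinite-volume two-point function at `β < β_c`, obtained from
finite volume by Prop. 5.2 of ADC; the present file supplies the finite-volume input in the
periodic box, where the statements hold for every `β ≥ 0` with no error term. They are the first
step of the tree's programme towards ADC's sliding-scale infrared bound (Thm 5.6,
`aizenmanDuminilCopin_slidingScaleInfraredBound` of `ImprovedTreeDiagramBound`).

## The argument (Kramers–Wannier / Schultz–Mattis–Lieb transfer matrix, in `d' + 1` dimensions)

1. (Part 4) Single out the coordinate `i`; a configuration is a cyclic sequence of layers
   `r_s ∈ {±1}^{(ℤ/Nℤ)^{d'}}`, `s ∈ ℤ/Nℤ`, and for `N ≥ 3` (each bond `{x, x+e_j}` counted once,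
   `sum_edgeFinset_torusGraph`) `-H = ∑_s E_h(r_s) + ∑_s ∑_y r_s(y) r_{s+1}(y)`, so
   `e^{-βH(σ)} = ∏_s A(r_s, r_{s+1})` with the symmetrised transfer matrix
   `A = D K D`, `D = diag(e^{βE_h/2})`, `K(r,r') = e^{β∑_y r_y r'_y}` (Schultz–Mattis–Lieb 1964, §II,
   `V = V₂^{1/2}V₁V₂^{1/2}`). `K` is positive semidefinite for `β ≥ 0` by the high-temperature
   expansion `e^{β r·r'} = ∑_S sinh^{|S|}β cosh^{|Sᶜ|}β r_S r'_S`, hence so is `A`.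
2. (Part 3) Cyclic sums with two diagonal insertions are traces:
   `∑_σ e^{-βH} f(r₀) g(r_n) = Tr(diag f · Aⁿ · diag g · A^{N-n})` (position-dependent version of
   `Z = Tr V^M`).
3. (Part 1) By the spectral theorem (Mathlib `Matrix.IsHermitian.spectral_theorem`), for real `f`,
   `Tr(diag f Aⁿ diag f Aᵐ) = ∑_{k,l} c_{kl} λ_lⁿ λ_kᵐ` with `λ ≥ 0` and symmetric `c_{kl} = M_{kl}² ≥ 0`,
   `M = Uᵀ diag f U`.
4. (Part 5) `N^{d'+1} Z Ĝ_N(k) = ∑_σ e^{-βH}|∑_x χ_k(x)σ_x|²` (translation invariance,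
   `isingTorusTwoPoint_eq_torusTwoPoint`; this also re-proves `Ĝ_N ≥ 0`), the character splits as
   `χ_k(ins_i(s,y)) = e(k_i s)χ_{k⊥}(y)`, and by stationarity in the direction `i` (invariance of the
   periodic Gibbs weight under the automorphism `x ↦ x + t e_i`)
   `N^{d'} Z Ĝ_N(k) = ∑_{n ∈ ℤ/Nℤ} e(k_i n) ∑_σ e^{-βH} Ψ_n conj Ψ_0`, `Ψ_s = ∑_y χ_{k⊥}(y) σ_{ins_i(s,y)}`;
   writing `Ψ = C + iS` the imaginary cross terms cancel by the symmetry of `A`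
   (`trace_diagonal_pow_comm`), leaving two two-insertion traces.
5. (Part 2) The discrete Fourier transform of the kernel: for an `N`-th root of unity `ω` and
   `λ ≠ μ`, `∑_{n<N} ωⁿ(μⁿλ^{N-n} + λⁿμ^{N-n}) = (λ^N-μ^N)(λ²-μ²)/((λ-μ)² + 2λμ(1 - Re ω))`
   (two geometric sums, `geom_sum₂_mul`), and `= 2Nλ^N[ω = 1]` for `λ = μ`; a positive multiple of
   `1/(B + Cu)` is decreasing in `u` and `u/(B + Cu)` increasing — whence (i) and (ii).

## References

* M. Aizenman, H. Duminil-Copin, Ann. of Math. 194 (2021) = arXiv:1912.07973, §5.2–5.3, Prop. 5.3,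
  Prop. 5.4 (i),(ii), Appendix A [AizenmanDuminilCopinAnnals2021] (held; pp. 16–18 read).
* R. Panis, arXiv:2309.05797, Thm 3.13, Rem. 3.14, Cor. 3.15 [Panis2023Triviality] (held; pp. 15–16 read).
* T. D. Schultz, D. C. Mattis, E. H. Lieb, Rev. Mod. Phys. 36 (1964) 856, §II [SchultzMattisLieb1964];
  G. Benettin, G. Gallavotti, G. Jona-Lasinio, A. L. Stella, Comm. Math. Phys. 30 (1973), App. a)
  [BenettinGallavottiJonaLasinioStella1973] (the high-temperature expansion of `e^{βr·r'}`).
* J. Fröhlich, B. Simon, T. Spencer, Comm. Math. Phys. 50 (1976), §3 [FrohlichSimonSpencer1976];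
  S. Friedli, Y. Velenik, *Statistical Mechanics of Lattice Systems* (2017), §10.4–10.5 [FriedliVelenik2017].

## Mathlib

`Matrix.IsHermitian.spectral_theorem` / `eigenvectorUnitary` / `PosSemidef.eigenvalues_nonneg`,
`Matrix.PosSemidef.conjTranspose_mul_mul_same`, `Matrix.trace_mul_comm`, `List.ofFn` products,
`geom_sum₂_mul`, `geom_sum_mul`, `ZMod.stdAddChar` / `ZMod.toCircle_apply`, `AddChar.map_nsmul_eq_pow`,
`Fin.insertNth` / `Fin.removeNth` / `Fin.succAboveCases`, `Fin.sum_univ_eq_sum_range`. Mathlib has no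
transfer matrix; `IsingTorusTransfer` (the `d = 2` Onsager stack, on `Fin N × Fin M`) is the model for
Part 3 and is imported for its small helpers (`snoc_apply_succ_eq`, and `exp_mul_eq_cosh_add_mul_sinh`
of `GKSInequalities`); its transfer lemmas concern a different graph and are re-done here on `torusGraph`.
-/

noncomputable section

open Matrix Finset

namespace Literature.Probability.LatticeModels

/-! ### Part 1. Two-insertion traces of a positive semidefinite matrix -/

section Spectral

variable {ι : Type*} [Fintype ι] [DecidableEq ι]

/-- **Spectral form of two-insertion traces.** For a positive semidefinite real symmetric matrix
`A` and a real diagonal observable `f` there are `λ_k ≥ 0` (the eigenvalues) and symmetric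
`c_{kl} ≥ 0` (the squared matrix elements of `diag f` in the eigenbasis) with
`Tr(diag f · Aⁿ · diag f · Aᵐ) = ∑_{k,l} c_{kl} λ_lⁿ λ_kᵐ` for all `n, m`
(Schultz–Mattis–Lieb 1964, §II; Glimm–Jaffe, *Quantum Physics*, §6 — the transfer-matrix /
spectral representation of two-point functions, finite-dimensional form). [folklore] -/
theorem trace_diagonal_pow_diagonal_pow_eq_sum {A : Matrix ι ι ℝ} (hA : A.PosSemidef) (f : ι → ℝ) :
    ∃ (ev : ι → ℝ) (c : ι → ι → ℝ), (∀ k, 0 ≤ ev k) ∧ (∀ k l, 0 ≤ c k l) ∧ (∀ k l, c k l = c l k) ∧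
      ∀ n m : ℕ, (diagonal f * A ^ n * diagonal f * A ^ m).trace =
        ∑ k, ∑ l, c k l * (ev l ^ n * ev k ^ m) := by
  classical
  have hH : A.IsHermitian := hA.1
  set U : Matrix ι ι ℝ := (hH.eigenvectorUnitary : Matrix ι ι ℝ) with hU
  set ev : ι → ℝ := hH.eigenvalues with hev
  have hspec : ∀ M : ℕ, A ^ M = U * diagonal (fun i => ev i ^ M) * star U := by
    intro M
    have h := congrArg (fun X : Matrix ι ι ℝ => X ^ M) hH.spectral_theorem
    rw [← map_pow, diagonal_pow, Unitary.conjStarAlgAut_apply] at h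
    rw [h]
    rfl
  have hUU : star U * U = 1 := Unitary.star_mul_self_of_mem hH.eigenvectorUnitary.2
  set M : Matrix ι ι ℝ := star U * diagonal f * U with hM
  have hMapply : ∀ k l, M k l = ∑ a, U a k * f a * U a l := by
    intro k l
    simp only [hM, Matrix.mul_apply, Matrix.star_apply, star_trivial, Matrix.diagonal_apply, mul_ite,
      mul_zero, Finset.sum_ite_eq', Finset.mem_univ, if_true]
  have hMsym : ∀ k l, M k l = M l k := by
    intro k l
    simp only [hMapply]
    exact Finset.sum_congr rfl fun a _ => by ring
  refine ⟨ev, fun k l => M k l * M l k, fun k => hA.eigenvalues_nonneg k, fun k l => ?_,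
    fun k l => mul_comm _ _, fun n m => ?_⟩
  · show 0 ≤ M k l * M l k
    rw [hMsym l k]
    exact mul_self_nonneg _
  set Dn : Matrix ι ι ℝ := diagonal fun i => ev i ^ n with hDn
  set Dm : Matrix ι ι ℝ := diagonal fun i => ev i ^ m with hDm
  calc (diagonal f * A ^ n * diagonal f * A ^ m).trace
      = (diagonal f * (U * Dn * star U) * diagonal f * (U * Dm * star U)).trace := by
        rw [hspec n, hspec m]
    _ = ((diagonal f * U * Dn * (star U * diagonal f * U) * Dm) * star U).trace := by
        simp only [Matrix.mul_assoc]
    _ = (star U * (diagonal f * U * Dn * (star U * diagonal f * U) * Dm)).trace :=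
        Matrix.trace_mul_comm _ _
    _ = (M * Dn * M * Dm).trace := by
        simp only [hM, Matrix.mul_assoc]
    _ = ∑ k, ∑ l, M k l * M l k * (ev l ^ n * ev k ^ m) := by
        simp only [Matrix.trace, Matrix.diag_apply, hDm, hDn, Matrix.mul_apply, Matrix.diagonal_apply,
          mul_ite, mul_zero, Finset.sum_ite_eq', Finset.mem_univ, if_true, Finset.sum_mul]
        refine Finset.sum_congr rfl fun k _ => Finset.sum_congr rfl fun l _ => ?_
        ring

end Spectral

/-! ### Part 2. The discrete Fourier transform of the kernels `n ↦ μⁿ λ^{N-n}` -/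

section Kernel

open Complex
open scoped ComplexConjugate

/-- The two-insertion geometric sum `Q_N(λ, μ; ω) = ∑_{n<N} ωⁿ μⁿ λ^{N-n}` (the contribution of one
ordered pair of eigenvalues to the Fourier transform in the transfer direction). [folklore] -/
def geomPairSum (N : ℕ) (lam mu : ℝ) (ω : ℂ) : ℂ :=
  ∑ n ∈ Finset.range N, ω ^ n * (mu : ℂ) ^ n * (lam : ℂ) ^ (N - n)

/-- `Q_N(λ, μ; ω) (μω - λ) = λ ((μω)^N - λ^N)` (geometric sum). [folklore] -/
theorem geomPairSum_mul_sub (N : ℕ) (lam mu : ℝ) (ω : ℂ) :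
    geomPairSum N lam mu ω * ((mu : ℂ) * ω - lam) = lam * (((mu : ℂ) * ω) ^ N - (lam : ℂ) ^ N) := by
  have key := geom_sum₂_mul ((mu : ℂ) * ω) (lam : ℂ) N
  have hQ : geomPairSum N lam mu ω =
      (lam : ℂ) * ∑ n ∈ Finset.range N, ((mu : ℂ) * ω) ^ n * (lam : ℂ) ^ (N - 1 - n) := by
    rw [geomPairSum, Finset.mul_sum]
    refine Finset.sum_congr rfl fun n hn => ?_
    have hn' : n < N := Finset.mem_range.1 hn
    have : N - n = (N - 1 - n) + 1 := by omega
    rw [this, pow_succ, mul_pow]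
    ring
  rw [hQ, mul_assoc, key]

/-- For `λ = μ`: `Q_N(λ, λ; ω) = λ^N ∑_{n<N} ωⁿ`. [folklore] -/
theorem geomPairSum_self (N : ℕ) (lam : ℝ) (ω : ℂ) :
    geomPairSum N lam lam ω = (lam : ℂ) ^ N * ∑ n ∈ Finset.range N, ω ^ n := by
  rw [geomPairSum, Finset.mul_sum]
  refine Finset.sum_congr rfl fun n hn => ?_
  have hn' : n < N := Finset.mem_range.1 hn
  have : N = n + (N - n) := by omega
  conv_rhs => rw [this, pow_add]
  ring

/-- For an `N`-th root of unity `ω ≠ 1`, `∑_{n<N} ωⁿ = 0`; for `ω = 1` it is `N`. [folklore] -/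
theorem sum_range_pow_eq_of_pow_eq_one {N : ℕ} {ω : ℂ} (hω : ω ^ N = 1) :
    ∑ n ∈ Finset.range N, ω ^ n = if ω = 1 then (N : ℂ) else 0 := by
  split_ifs with h1
  · simp [h1]
  · have key := geom_sum_mul ω N
    rw [hω, sub_self] at key
    exact (mul_eq_zero.1 key).resolve_right (sub_ne_zero.2 h1)

/-- **The symmetrised pair sum is a real Lorentzian in `1 - Re ω`.** For `ω` on the unit circle with
`ω^N = 1` and real `λ ≠ μ`:
`Q_N(λ,μ;ω) + Q_N(μ,λ;ω) = (λ^N - μ^N)(λ² - μ²) / ((λ - μ)² + 2λμ(1 - Re ω))`. [folklore] -/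
theorem geomPairSum_add_geomPairSum_of_ne {N : ℕ} {ω : ℂ} (hω : ω ^ N = 1) (hω1 : ‖ω‖ = 1)
    {lam mu : ℝ} (hne : lam ≠ mu) (hprod : 0 ≤ lam * mu) :
    geomPairSum N lam mu ω + geomPairSum N mu lam ω =
      (((lam ^ N - mu ^ N) * (lam ^ 2 - mu ^ 2) / ((lam - mu) ^ 2 + 2 * (lam * mu) * (1 - ω.re)) : ℝ) : ℂ) := by
  have e1 := geomPairSum_mul_sub N lam mu ω
  have e2 := geomPairSum_mul_sub N mu lam ω
  rw [mul_pow, hω, mul_one] at e1 e2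
  -- the identity `(Q₁ + Q₂) · (-(μω - λ)(λω - μ)) = ω (λ^N - μ^N)(λ² - μ²)`
  have key : (geomPairSum N lam mu ω + geomPairSum N mu lam ω) *
      (-(((mu : ℂ) * ω - lam) * ((lam : ℂ) * ω - mu))) =
      ω * (((lam : ℂ) ^ N - (mu : ℂ) ^ N) * ((lam : ℂ) ^ 2 - (mu : ℂ) ^ 2)) := by
    linear_combination (-((lam : ℂ) * ω - mu)) * e1 + (-((mu : ℂ) * ω - lam)) * e2
  -- `ω ≠ 0`, `ω⁻¹ = conj ω`, and `-(μω - λ)(λω - μ) = ω · D` with `D` the real denominator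
  have hω0 : ω ≠ 0 := by
    intro h; rw [h, norm_zero] at hω1; exact zero_ne_one hω1
  have hnormSq : Complex.normSq ω = 1 := by
    rw [Complex.normSq_eq_norm_sq, hω1, one_pow]
  have hinv : ω⁻¹ = conj ω := by
    rw [Complex.inv_def, hnormSq]; simp
  set D : ℝ := (lam - mu) ^ 2 + 2 * (lam * mu) * (1 - ω.re) with hD
  have hDpos : 0 < D := by
    have h1 : 0 < (lam - mu) ^ 2 := by positivity
    have h2 : 0 ≤ 2 * (lam * mu) * (1 - ω.re) := by
      have : ω.re ≤ 1 := by
        have := Complex.re_le_norm ω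
        rwa [hω1] at this
      positivity
    linarith
  have hDω : -(((mu : ℂ) * ω - lam) * ((lam : ℂ) * ω - mu)) = ω * (D : ℂ) := by
    have hre : ((ω.re : ℝ) : ℂ) = (ω + conj ω) / 2 := by
      rw [Complex.add_conj]; push_cast; ring
    have hωω : ω * conj ω = 1 := by
      rw [← hinv, mul_inv_cancel₀ hω0]
    rw [hD]
    push_cast
    rw [hre]
    linear_combination ((lam : ℂ) * mu) * hωω
  rw [hDω] at key
  have hD0 : (D : ℂ) ≠ 0 := by exact_mod_cast hDpos.ne'
  have : geomPairSum N lam mu ω + geomPairSum N mu lam ω =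
      (((lam : ℂ) ^ N - (mu : ℂ) ^ N) * ((lam : ℂ) ^ 2 - (mu : ℂ) ^ 2)) / (D : ℂ) := by
    rw [eq_div_iff hD0]
    have := key
    rw [← mul_assoc] at this
    -- cancel `ω`
    have h2 : (geomPairSum N lam mu ω + geomPairSum N mu lam ω) * (D : ℂ) * ω =
        ((lam : ℂ) ^ N - (mu : ℂ) ^ N) * ((lam : ℂ) ^ 2 - (mu : ℂ) ^ 2) * ω := by
      linear_combination this
    exact mul_right_cancel₀ hω0 h2
  rw [this]
  push_cast
  rfl


/-! #### The symmetrised kernel as a function of `u = 1 - Re ω` and its monotonicity -/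

/-- The symmetrised pair kernel as a function of `u = 1 - cos θ ∈ [0, 2]`:
`R_N(λ, μ; u) = (λ^N - μ^N)(λ² - μ²)/((λ-μ)² + 2λμu)` for `λ ≠ μ`, and `2Nλ^N · [u = 0]` for
`λ = μ` (a positive multiple of a Lorentzian in `u`, resp. a point mass at `u = 0`). [folklore] -/
def pairKernel (N : ℕ) (lam mu u : ℝ) : ℝ :=
  if lam = mu then (if u = 0 then 2 * N * lam ^ N else 0)
  else (lam ^ N - mu ^ N) * (lam ^ 2 - mu ^ 2) / ((lam - mu) ^ 2 + 2 * (lam * mu) * u)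

/-- On the unit circle, `Re ω = 1` forces `ω = 1`. [folklore] -/
theorem eq_one_of_norm_eq_one_of_re_eq_one {ω : ℂ} (hω1 : ‖ω‖ = 1) (hre : ω.re = 1) : ω = 1 := by
  have h : ω.re ^ 2 + ω.im ^ 2 = 1 := by
    have := Complex.normSq_eq_norm_sq ω
    rw [hω1, one_pow, Complex.normSq_apply] at this
    nlinarith [this]
  rw [hre] at h
  have him : ω.im = 0 := by nlinarith
  exact Complex.ext (by simp [hre]) (by simp [him])

/-- **The symmetrised pair sum equals the kernel at `u = 1 - Re ω`.** [folklore] -/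
theorem geomPairSum_add_geomPairSum {N : ℕ} {ω : ℂ} (hω : ω ^ N = 1) (hω1 : ‖ω‖ = 1)
    {lam mu : ℝ} (hprod : 0 ≤ lam * mu) :
    geomPairSum N lam mu ω + geomPairSum N mu lam ω = (pairKernel N lam mu (1 - ω.re) : ℂ) := by
  by_cases hne : lam = mu
  · subst hne
    rw [geomPairSum_self, sum_range_pow_eq_of_pow_eq_one hω, pairKernel, if_pos rfl]
    by_cases h1 : ω = 1
    · rw [if_pos h1, if_pos (by rw [h1, Complex.one_re, sub_self])]
      push_cast
      ring
    · have : (1 : ℝ) - ω.re ≠ 0 := by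
        intro h
        exact h1 (eq_one_of_norm_eq_one_of_re_eq_one hω1 (by linarith))
      rw [if_neg h1, if_neg this]
      push_cast
      ring
  · rw [geomPairSum_add_geomPairSum_of_ne hω hω1 hne hprod, pairKernel, if_neg hne]

/-- `(λ^N - μ^N)(λ² - μ²) ≥ 0` for `λ, μ ≥ 0`. [folklore] -/
theorem pow_sub_pow_mul_sq_sub_sq_nonneg (N : ℕ) {lam mu : ℝ} (hl : 0 ≤ lam) (hm : 0 ≤ mu) :
    0 ≤ (lam ^ N - mu ^ N) * (lam ^ 2 - mu ^ 2) := by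
  rcases le_total mu lam with h | h
  · exact mul_nonneg (sub_nonneg.2 (pow_le_pow_left₀ hm h N)) (sub_nonneg.2 (pow_le_pow_left₀ hm h 2))
  · exact mul_nonneg_of_nonpos_of_nonpos (sub_nonpos.2 (pow_le_pow_left₀ hl h N))
      (sub_nonpos.2 (pow_le_pow_left₀ hl h 2))

/-- The kernel is nonnegative (`u ≥ 0`, `λ, μ ≥ 0`). [folklore] -/
theorem pairKernel_nonneg (N : ℕ) {lam mu u : ℝ} (hl : 0 ≤ lam) (hm : 0 ≤ mu) (hu : 0 ≤ u) :
    0 ≤ pairKernel N lam mu u := by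
  unfold pairKernel
  split_ifs with h1 h2
  · positivity
  · exact le_rfl
  · have hB : 0 < (lam - mu) ^ 2 := by
      have : lam - mu ≠ 0 := sub_ne_zero.2 h1
      positivity
    exact div_nonneg (pow_sub_pow_mul_sq_sub_sq_nonneg N hl hm) (by positivity)

/-- **The kernel is antitone in `u`** (decreasing in `|θ|`, `u = 1 - cos θ`). [folklore] -/
theorem pairKernel_antitone (N : ℕ) {lam mu u u' : ℝ} (hl : 0 ≤ lam) (hm : 0 ≤ mu) (hu : 0 ≤ u)
    (huu' : u ≤ u') : pairKernel N lam mu u' ≤ pairKernel N lam mu u := by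
  unfold pairKernel
  split_ifs with h1 h2 h3 h3
  · exact le_rfl
  · exfalso; exact h3 (le_antisymm (h2 ▸ huu') hu)
  · positivity
  · exact le_rfl
  · have hB : 0 < (lam - mu) ^ 2 := by
      have : lam - mu ≠ 0 := sub_ne_zero.2 h1
      positivity
    exact div_le_div_of_nonneg_left (pow_sub_pow_mul_sq_sub_sq_nonneg N hl hm) (by positivity)
      (by nlinarith [mul_nonneg hl hm])

/-- **`u · R(u)` is monotone in `u`** (`ℰ₁(θ) Ĝ` increasing in `|θ|`). [folklore] -/
theorem mul_pairKernel_monotone (N : ℕ) {lam mu u u' : ℝ} (hl : 0 ≤ lam) (hm : 0 ≤ mu) (hu : 0 ≤ u)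
    (huu' : u ≤ u') : u * pairKernel N lam mu u ≤ u' * pairKernel N lam mu u' := by
  unfold pairKernel
  split_ifs with h1 h2 h3 h3
  · rw [h2, h3]
  · rw [h2, zero_mul]
    exact mul_nonneg (hu.trans huu') le_rfl
  · exfalso; exact h2 (le_antisymm (h3 ▸ huu') hu)
  · simp
  · set P := (lam ^ N - mu ^ N) * (lam ^ 2 - mu ^ 2) with hP
    have hP0 : 0 ≤ P := pow_sub_pow_mul_sq_sub_sq_nonneg N hl hm
    have hB : 0 < (lam - mu) ^ 2 := by
      have : lam - mu ≠ 0 := sub_ne_zero.2 h1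
      positivity
    have hlm : 0 ≤ lam * mu := mul_nonneg hl hm
    have hD : 0 < (lam - mu) ^ 2 + 2 * (lam * mu) * u := by positivity
    have hD' : 0 < (lam - mu) ^ 2 + 2 * (lam * mu) * u' := by
      have : 0 ≤ u' := hu.trans huu'
      positivity
    rw [mul_div_assoc', mul_div_assoc', div_le_div_iff₀ hD hD']
    have : u' * P * ((lam - mu) ^ 2 + 2 * (lam * mu) * u) - u * P * ((lam - mu) ^ 2 + 2 * (lam * mu) * u') =
        P * (lam - mu) ^ 2 * (u' - u) := by ring
    nlinarith [mul_nonneg (mul_nonneg hP0 hB.le) (sub_nonneg.2 huu')]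

/-! #### Fourier transforms of two-insertion spectral sums -/

/-- **The Fourier transform in the transfer direction of a two-insertion spectral sum.** If
`a(n) = ∑_{k,l} c_{kl} λ_lⁿ λ_k^{N-n}` with `λ ≥ 0` and symmetric `c ≥ 0` (the form of
`Tr(diag f Aⁿ diag f A^{N-n})`, `trace_diagonal_pow_diagonal_pow_eq_sum`), then for every `N`-th root
of unity `ω`, `∑_{n<N} ωⁿ a(n) = ½ ∑_{k,l} c_{kl} R_N(λ_k, λ_l; 1 - Re ω)` — a nonnegative combination of
Lorentzians in `1 - Re ω` plus a point mass at `ω = 1` (Glimm–Jaffe 1973 / Aizenman–Duminil-Copin 2021,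
Prop. 5.3–5.4, finite-volume form). [folklore] -/
theorem sum_pow_mul_spectralSum_eq {ι : Type*} [Fintype ι] {N : ℕ} {ω : ℂ} (hω : ω ^ N = 1)
    (hω1 : ‖ω‖ = 1) {ev : ι → ℝ} {c : ι → ι → ℝ} (hev : ∀ k, 0 ≤ ev k)
    (hsym : ∀ k l, c k l = c l k) :
    ∑ n ∈ Finset.range N, ω ^ n * ((∑ k, ∑ l, c k l * (ev l ^ n * ev k ^ (N - n)) : ℝ) : ℂ) =
      (((1 / 2 : ℝ) * ∑ k, ∑ l, c k l * pairKernel N (ev k) (ev l) (1 - ω.re) : ℝ) : ℂ) := by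
  -- exchange the sums: `∑_n ωⁿ a(n) = ∑_{k,l} c_{kl} Q(λ_k, λ_l)`
  have h1 : ∑ n ∈ Finset.range N, ω ^ n * ((∑ k, ∑ l, c k l * (ev l ^ n * ev k ^ (N - n)) : ℝ) : ℂ) =
      ∑ k, ∑ l, (c k l : ℂ) * geomPairSum N (ev k) (ev l) ω := by
    push_cast
    simp only [Finset.mul_sum]
    rw [Finset.sum_comm]
    refine Finset.sum_congr rfl fun k _ => ?_
    rw [Finset.sum_comm]
    refine Finset.sum_congr rfl fun l _ => ?_
    unfold geomPairSum
    rw [Finset.mul_sum]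
    refine Finset.sum_congr rfl fun n _ => ?_
    ring
  -- symmetrise using `c_{kl} = c_{lk}`
  have h2 : ∑ k, ∑ l, (c k l : ℂ) * geomPairSum N (ev k) (ev l) ω =
      ∑ k, ∑ l, (c k l : ℂ) * geomPairSum N (ev l) (ev k) ω := by
    rw [Finset.sum_comm]
    exact Finset.sum_congr rfl fun k _ => Finset.sum_congr rfl fun l _ => by rw [hsym]
  have h3 : ∑ k, ∑ l, (c k l : ℂ) * geomPairSum N (ev k) (ev l) ω =
      (1 / 2 : ℂ) * ∑ k, ∑ l, (c k l : ℂ) * (geomPairSum N (ev k) (ev l) ω + geomPairSum N (ev l) (ev k) ω) := by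
    have : ∑ k, ∑ l, (c k l : ℂ) * (geomPairSum N (ev k) (ev l) ω + geomPairSum N (ev l) (ev k) ω) =
        ∑ k, ∑ l, (c k l : ℂ) * geomPairSum N (ev k) (ev l) ω +
          ∑ k, ∑ l, (c k l : ℂ) * geomPairSum N (ev l) (ev k) ω := by
      rw [← Finset.sum_add_distrib]
      refine Finset.sum_congr rfl fun k _ => ?_
      rw [← Finset.sum_add_distrib]
      exact Finset.sum_congr rfl fun l _ => by ring
    rw [this, ← h2]
    ring
  rw [h1, h3]
  push_cast
  rw [Finset.mul_sum, Finset.mul_sum]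
  refine Finset.sum_congr rfl fun k _ => ?_
  rw [Finset.mul_sum, Finset.mul_sum]
  refine Finset.sum_congr rfl fun l _ => ?_
  rw [geomPairSum_add_geomPairSum hω hω1 (mul_nonneg (hev k) (hev l))]

end Kernel



/-! ### Part 3. Cyclic sums are traces of products of (position-dependent) transfer matrices -/

section Cyclic

variable {ι : Type*} [Fintype ι] [DecidableEq ι]

/-- The product of position-dependent transfer weights along a chain `a, r₁, …, rₙ, b`. [folklore] -/
def chainProd' {n : ℕ} (T : Fin (n + 1) → Matrix ι ι ℝ) (a : ι) (rs : Fin n → ι) (b : ι) : ℝ :=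
  ∏ j : Fin (n + 1), T j ((Fin.cons a (Fin.snoc rs b) : Fin (n + 2) → ι) j.castSucc)
    ((Fin.cons a (Fin.snoc rs b) : Fin (n + 2) → ι) j.succ)

/-- **Entries of a product of matrices are chain sums**:
`(T₀ T₁ ⋯ Tₙ)_{ab} = ∑_{r₁,…,rₙ} (T₀)_{a r₁} (T₁)_{r₁ r₂} ⋯ (Tₙ)_{rₙ b}`. [folklore] -/
theorem listProd_ofFn_apply_eq_sum_chainProd' (n : ℕ) (T : Fin (n + 1) → Matrix ι ι ℝ) (a b : ι) :
    (List.ofFn T).prod a b = ∑ rs : Fin n → ι, chainProd' T a rs b := by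
  induction n generalizing a b with
  | zero =>
    rw [List.ofFn_succ, List.ofFn_zero, List.prod_cons, List.prod_nil, Matrix.mul_one,
      Fintype.sum_unique]
    unfold chainProd'
    rw [Fin.prod_univ_one]
    simp only [Fin.castSucc_zero, Fin.cons_zero, Fin.succ_zero_eq_one, Fin.cons_one]
    rfl
  | succ n ih =>
    rw [List.ofFn_succ, List.prod_cons, Matrix.mul_apply]
    simp_rw [ih]
    rw [← Equiv.sum_comp (Fin.consEquiv fun _ => ι), Fintype.sum_prod_type]
    simp only [Finset.mul_sum]
    refine Finset.sum_congr rfl fun r _ => Finset.sum_congr rfl fun rs _ => ?_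
    -- peel the first factor of the chain `a, r, rs, b`
    simp only [Fin.consEquiv, Equiv.coe_fn_mk]
    have hc : (Fin.snoc (Fin.cons r rs) b : Fin (n + 2) → ι) = Fin.cons r (Fin.snoc rs b) :=
      (Fin.cons_snoc_eq_snoc_cons r rs b).symm
    simp only [chainProd', hc]
    rw [Fin.prod_univ_succ (n := n + 1)]
    simp only [Fin.castSucc_zero, Fin.cons_zero, Fin.cons_succ, ← Fin.succ_castSucc]

/-- **Cyclic sums are traces**: `∑_{r₀,…,rₙ} ∏_j (T_j)_{r_j r_{j+1}} = Tr(T₀ T₁ ⋯ Tₙ)` (indices mod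
`n + 1`; Kramers–Wannier 1941 / Schultz–Mattis–Lieb 1964, §II, `Z = Tr V^M`, here with
position-dependent matrices so as to accommodate insertions of diagonal observables). [folklore] -/
theorem sum_prod_cyclic_eq_trace_listProd (n : ℕ) (T : Fin (n + 1) → Matrix ι ι ℝ) :
    ∑ rs : Fin (n + 1) → ι, ∏ j, T j (rs j) (rs (j + 1)) = ((List.ofFn T).prod).trace := by
  classical
  rw [Matrix.trace]
  simp only [Matrix.diag, listProd_ofFn_apply_eq_sum_chainProd']
  rw [← Equiv.sum_comp (Fin.consEquiv fun _ => ι), Fintype.sum_prod_type]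
  refine Finset.sum_congr rfl fun a _ => Finset.sum_congr rfl fun rs _ => ?_
  simp only [Fin.consEquiv, Equiv.coe_fn_mk]
  have hcyc : ∀ j : Fin (n + 1), (Fin.cons a rs : Fin (n + 1) → ι) (j + 1) =
      (Fin.snoc (Fin.cons a rs : Fin (n + 1) → ι) ((Fin.cons a rs : Fin (n + 1) → ι) 0) :
        Fin (n + 2) → ι) j.succ := fun j => (snoc_apply_succ_eq _ j).symm
  simp only [hcyc, Fin.cons_zero, chainProd', Fin.cons_snoc_eq_snoc_cons]
  refine Finset.prod_congr rfl fun j _ => ?_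
  rw [Fin.snoc_castSucc]

/-! #### Products with one or two special positions -/

/-- `∏_{j<m} (diag(w_j) A)`: the list product of the matrices `diag (w j) * A`. [folklore] -/
def diagProd (A : Matrix ι ι ℝ) (w : ℕ → ι → ℝ) (m : ℕ) : Matrix ι ι ℝ :=
  (List.ofFn fun j : Fin m => diagonal (w j) * A).prod

/-- Unfolding the first factor. [folklore] -/
theorem diagProd_succ (A : Matrix ι ι ℝ) (w : ℕ → ι → ℝ) (m : ℕ) :
    diagProd A w (m + 1) = diagonal (w 0) * A * diagProd A (fun j => w (j + 1)) m := by
  rw [diagProd, List.ofFn_succ, List.prod_cons, diagProd]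
  simp only [Fin.val_zero, Fin.val_succ, Matrix.mul_assoc]

omit [Fintype ι] in
/-- `diag 1 = 1`. [folklore] -/
theorem diagonal_pi_one : diagonal (1 : ι → ℝ) = 1 := diagonal_one

/-- With unit weights the product is a power. [folklore] -/
theorem diagProd_eq_pow (A : Matrix ι ι ℝ) {w : ℕ → ι → ℝ} {m : ℕ} (hw : ∀ j < m, w j = 1) :
    diagProd A w m = A ^ m := by
  induction m generalizing w with
  | zero => simp [diagProd]
  | succ m ih =>
    rw [diagProd_succ, hw 0 (by omega), diagonal_pi_one, Matrix.one_mul,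
      ih (fun j hj => hw (j + 1) (by omega)), pow_succ']

/-- **One special position**: if `w_j = 1` for `j ≠ n` (`j < m`, `n < m`) then
`∏_j diag(w_j) A = Aⁿ diag(w_n) A^{m-n}`. [folklore] -/
theorem diagProd_eq_of_single (A : Matrix ι ι ℝ) {w : ℕ → ι → ℝ} {n m : ℕ} (hnm : n < m)
    (hw : ∀ j < m, j ≠ n → w j = 1) :
    diagProd A w m = A ^ n * diagonal (w n) * A ^ (m - n) := by
  induction n generalizing w m with
  | zero =>
    obtain ⟨m, rfl⟩ : ∃ m', m = m' + 1 := ⟨m - 1, by omega⟩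
    rw [diagProd_succ, diagProd_eq_pow A (fun j hj => hw (j + 1) (by omega) (by omega)), pow_zero,
      Matrix.one_mul, Nat.sub_zero, pow_succ', Matrix.mul_assoc]
  | succ n ih =>
    obtain ⟨m, rfl⟩ : ∃ m', m = m' + 1 := ⟨m - 1, by omega⟩
    rw [diagProd_succ, hw 0 (by omega) (by omega), diagonal_pi_one, Matrix.one_mul,
      ih (by omega) (fun j hj hjn => hw (j + 1) (by omega) (by omega)), Nat.succ_sub_succ, pow_succ']
    simp only [Matrix.mul_assoc]

/-- The weights with `f` inserted at position `0` and `g` at position `n`. [folklore] -/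
def twoWeights (f g : ι → ℝ) (n : ℕ) : ℕ → ι → ℝ :=
  fun j => (if j = 0 then f else 1) * (if j = n then g else 1)

omit [Fintype ι] [DecidableEq ι] in
/-- Both insertions at `0`. [folklore] -/
theorem twoWeights_zero_zero (f g : ι → ℝ) : twoWeights f g 0 0 = f * g := by
  simp [twoWeights]

omit [Fintype ι] [DecidableEq ι] in
/-- Unit weights away from the insertions (`n = 0`). [folklore] -/
theorem twoWeights_zero_succ (f g : ι → ℝ) (j : ℕ) : twoWeights f g 0 (j + 1) = 1 := by
  simp [twoWeights]

omit [Fintype ι] [DecidableEq ι] in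
/-- The first insertion (`n ≠ 0`). [folklore] -/
theorem twoWeights_succ_zero (f g : ι → ℝ) (n : ℕ) : twoWeights f g (n + 1) 0 = f := by
  simp [twoWeights]

omit [Fintype ι] [DecidableEq ι] in
/-- Shifting the weights by one position. [folklore] -/
theorem twoWeights_succ_succ (f g : ι → ℝ) (n j : ℕ) :
    twoWeights f g (n + 1) (j + 1) = if j = n then g else 1 := by
  by_cases h : j = n <;> simp [twoWeights, h]

/-- **Two insertions**: `∏_{j<m} diag(w_j) A = diag f · Aⁿ · diag g · A^{m-n}` for the weights
`twoWeights f g n` and `n < m`. [folklore] -/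
theorem diagProd_twoWeights (A : Matrix ι ι ℝ) (f g : ι → ℝ) {n m : ℕ} (hnm : n < m) :
    diagProd A (twoWeights f g n) m = diagonal f * A ^ n * diagonal g * A ^ (m - n) := by
  obtain ⟨m, rfl⟩ : ∃ m', m = m' + 1 := ⟨m - 1, by omega⟩
  rw [diagProd_succ]
  cases n with
  | zero =>
    rw [twoWeights_zero_zero, diagProd_eq_pow A (fun j _ => twoWeights_zero_succ f g j), pow_zero,
      Matrix.mul_one, Nat.sub_zero, pow_succ']
    have : diagonal (f * g) = diagonal f * diagonal g := by
      rw [diagonal_mul_diagonal]; rfl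
    simp only [this, Matrix.mul_assoc]
  | succ n =>
    rw [twoWeights_succ_zero]
    have hw : ∀ j < m, j ≠ n → (fun j => twoWeights f g (n + 1) (j + 1)) j = 1 := by
      intro j _ hjn
      simp only [twoWeights_succ_succ, if_neg hjn]
    rw [diagProd_eq_of_single A (by omega) hw]
    simp only [twoWeights_succ_succ, ite_true, Nat.succ_sub_succ, pow_succ', Matrix.mul_assoc]

/-- **Cyclic sums with two diagonal insertions are two-insertion traces**:
`∑_{r} f(r₀) g(r_n) ∏_j A_{r_j r_{j+1}} = Tr(diag f · Aⁿ · diag g · A^{N-n})` (`N = m + 1 > n`).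
[cite: SchultzMattisLieb1964, §II (Z⟨σσ⟩ = Tr(σ V^k σ V^{M-k}))] -/
theorem sum_mul_mul_prod_cyclic_eq_trace (A : Matrix ι ι ℝ) (f g : ι → ℝ) (m : ℕ) (n : Fin (m + 1)) :
    ∑ rs : Fin (m + 1) → ι, f (rs 0) * g (rs n) * ∏ j, A (rs j) (rs (j + 1)) =
      (diagonal f * A ^ (n : ℕ) * diagonal g * A ^ (m + 1 - n)).trace := by
  have key := sum_prod_cyclic_eq_trace_listProd m (fun j => diagonal (twoWeights f g n j) * A)
  rw [← diagProd_twoWeights A f g n.isLt, diagProd, ← key]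
  refine Finset.sum_congr rfl fun rs _ => ?_
  simp only [Matrix.diagonal_mul, Finset.prod_mul_distrib]
  congr 1
  -- `∏_j w_j(r_j) = f(r₀) g(r_n)`
  simp only [twoWeights, Pi.mul_apply, Finset.prod_mul_distrib]
  congr 1
  · rw [Finset.prod_eq_single (0 : Fin (m + 1))]
    · simp
    · intro j _ hj
      rw [if_neg (fun h => hj (Fin.ext (by simpa using h)))]
      rfl
    · simp
  · rw [Finset.prod_eq_single n]
    · simp
    · intro j _ hj
      rw [if_neg (fun h => hj (Fin.ext h))]
      rfl
    · simp

end Cyclic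

/-! ### Part 4. The torus Ising model as a cyclic transfer chain in one direction -/

section Layers

variable {d' N : ℕ} [NeZero N]

/-- A **layer configuration**: the spins on one hyperplane `{x_i = s} ≅ (ℤ/Nℤ)^{d'}` of the torus
`(ℤ/Nℤ)^{d'+1}` (the index set of the transfer matrix). [cite: SchultzMattisLieb1964, §II] -/
abbrev Layer (d' N : ℕ) : Type := SpinConfig (TorusSite d' N)

/-- The site of the torus `(ℤ/Nℤ)^{d'+1}` with `i`-th coordinate `s` and remaining coordinates `y`
(`Fin.insertNth` at a constant family). [folklore] -/
def Torus.ins (i : Fin (d' + 1)) (s : ZMod N) (y : TorusSite d' N) : TorusSite (d' + 1) N :=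
  @Fin.insertNth d' (fun _ => ZMod N) i s y

omit [NeZero N] in
/-- The `i`-th coordinate of `ins_i(s, y)` is `s`. [folklore] -/
@[simp] theorem Torus.ins_apply_same (i : Fin (d' + 1)) (s : ZMod N) (y : TorusSite d' N) :
    Torus.ins i s y i = s := by
  simp [Torus.ins]

omit [NeZero N] in
/-- The remaining coordinates of `ins_i(s, y)` are `y`. [folklore] -/
@[simp] theorem Torus.ins_apply_succAbove (i : Fin (d' + 1)) (s : ZMod N) (y : TorusSite d' N) (j : Fin d') :
    Torus.ins i s y (i.succAbove j) = y j := by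
  simp [Torus.ins]

omit [NeZero N] in
/-- Reassembling a site from its `i`-th coordinate and the rest. [folklore] -/
@[simp] theorem Torus.ins_self_removeNth (i : Fin (d' + 1)) (x : TorusSite (d' + 1) N) :
    Torus.ins i (x i) (i.removeNth x) = x := by
  simp [Torus.ins]

omit [NeZero N] in
/-- Removing the `i`-th coordinate of `ins_i(s, y)` gives back `y`. [folklore] -/
@[simp] theorem Torus.removeNth_ins (i : Fin (d' + 1)) (s : ZMod N) (y : TorusSite d' N) :
    i.removeNth (Torus.ins i s y) = y := by
  simp [Torus.ins]

/-- The coordinate splitting `(ℤ/Nℤ)^{d'+1} ≃ ℤ/Nℤ × (ℤ/Nℤ)^{d'}` along `i`. [folklore] -/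
def Torus.splitEquiv (i : Fin (d' + 1)) : ZMod N × TorusSite d' N ≃ TorusSite (d' + 1) N where
  toFun p := Torus.ins i p.1 p.2
  invFun x := (x i, i.removeNth x)
  left_inv p := by simp
  right_inv x := by simp

/-- The `s`-th layer orthogonal to the direction `i` of a torus configuration. [folklore] -/
def layerOf (i : Fin (d' + 1)) (σ : SpinConfig (TorusSite (d' + 1) N)) (s : ZMod N) : Layer d' N :=
  fun y => σ (Torus.ins i s y)

/-- Torus configurations as sequences of layers (the coordinate `i` singled out). [folklore] -/
def layersEquiv (i : Fin (d' + 1)) : SpinConfig (TorusSite (d' + 1) N) ≃ (ZMod N → Layer d' N) where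
  toFun σ := layerOf i σ
  invFun rs := fun x => rs (x i) (i.removeNth x)
  left_inv σ := by
    funext x
    simp [layerOf]
  right_inv rs := by
    funext s y
    simp [layerOf]

omit [NeZero N] in
/-- A step in the transfer direction: `ins_i(s, y) + e_i = ins_i(s + 1, y)`. [folklore] -/
theorem Torus.ins_add_single_self (i : Fin (d' + 1)) (s : ZMod N) (y : TorusSite d' N) :
    Torus.ins i s y + Pi.single i (1 : ZMod N) = Torus.ins i (s + 1) y := by
  funext x
  refine Fin.succAboveCases i ?_ (fun j => ?_) x
  · simp
  · simp [Fin.succAbove_ne]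

omit [NeZero N] in
/-- A step inside the layer: `ins_i(s, y) + e_{i.succAbove j} = ins_i(s, y + e_j)`. [folklore] -/
theorem Torus.ins_add_single_succAbove (i : Fin (d' + 1)) (s : ZMod N) (y : TorusSite d' N) (j : Fin d') :
    Torus.ins i s y + Pi.single (i.succAbove j) (1 : ZMod N) = Torus.ins i s (y + Pi.single j 1) := by
  funext x
  refine Fin.succAboveCases i ?_ (fun j' => ?_) x
  · simp [Fin.ne_succAbove]
  · by_cases h : j' = j
    · subst h; simp
    · simp [h, (Fin.succAbove_right_injective (p := i)).ne h]

/-- Sums over the torus as iterated sums over the coordinate `i` and the layer. [folklore] -/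
theorem sum_torus_eq_sum_sum (i : Fin (d' + 1)) {M : Type*} [AddCommMonoid M]
    (F : TorusSite (d' + 1) N → M) :
    ∑ x, F x = ∑ s : ZMod N, ∑ y : TorusSite d' N, F (Torus.ins i s y) := by
  rw [← Fintype.sum_prod_type', ← (Torus.splitEquiv i).sum_comp]
  rfl

end Layers

section Transfer

variable {d' N : ℕ} [NeZero N]

/-- The **intra-layer energy** (bonds inside the layer, each counted once as `{y, y + e_j}`, plus the
field term): `E_h(r) = ∑_y ∑_j r_y r_{y+e_j} + h ∑_y r_y`. [cite: SchultzMattisLieb1964, §II (V₂)] -/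
def layerEnergy (h : ℝ) (r : Layer d' N) : ℝ :=
  (∑ y, ∑ j : Fin d', spinAt y r * spinAt (y + Pi.single j 1) r) + h * ∑ y, spinAt y r

/-- The **inter-layer coupling** `C(r, r') = ∑_y r_y r'_y` (the bonds in the transfer direction).
[cite: SchultzMattisLieb1964, §II (V₁)] -/
def couplingEnergy (r r' : Layer d' N) : ℝ := ∑ y, spinAt y r * spinAt y r'

/-- The inter-layer coupling is symmetric. [folklore] -/
theorem couplingEnergy_comm (r r' : Layer d' N) : couplingEnergy r r' = couplingEnergy r' r :=
  Finset.sum_congr rfl fun _ _ => mul_comm _ _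

/-- On the whole graph the interacting edges of the free boundary condition are all edges. [folklore] -/
theorem edgesIn_univ_eq {V : Type*} [Fintype V] [DecidableEq V] (G : SimpleGraph V) [DecidableRel G.Adj] :
    edgesIn G Finset.univ = G.edgeFinset := by
  ext e
  rw [mem_edgesIn_iff, SimpleGraph.mem_edgeFinset]
  exact ⟨fun h => h.1, fun h => ⟨h, fun x _ => Finset.mem_univ x⟩⟩

omit [NeZero N] in
/-- `σ_{ins_i(s,y)} = (r_s)_y` for the layers `r = layerOf i σ`. [folklore] -/
theorem spinAt_ins (i : Fin (d' + 1)) (σ : SpinConfig (TorusSite (d' + 1) N)) (s : ZMod N)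
    (y : TorusSite d' N) : spinAt (Torus.ins i s y) σ = spinAt y (layerOf i σ s) := rfl

/-- **The energy of the torus by layers** (Kramers–Wannier 1941; Schultz–Mattis–Lieb 1964, §II,
eqs. (2.2)–(2.3), in `d' + 1` dimensions): for `N ≥ 3`,
`-H(σ) = ∑_s E_h(r_s) + ∑_s C(r_s, r_{s+1})` with `r_s` the `s`-th layer orthogonal to `e_i`.
[cite: SchultzMattisLieb1964, §II eqs. (2.2)–(2.3)] -/
theorem neg_isingHamiltonian_torus_eq_layers (hN : 3 ≤ N) (i : Fin (d' + 1)) (h : ℝ)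
    (σ : SpinConfig (TorusSite (d' + 1) N)) :
    -isingHamiltonian (torusGraph (d' + 1) N) Finset.univ h .free σ =
      ∑ s, layerEnergy h (layerOf i σ s) + ∑ s, couplingEnergy (layerOf i σ s) (layerOf i σ (s + 1)) := by
  simp only [isingHamiltonian, interactionEdges_free, edgesIn_univ_eq, neg_sub, sub_neg_eq_add,
    sum_edgeFinset_torusGraph hN, bondSpin_mk]
  simp only [sum_torus_eq_sum_sum i]
  simp only [Fin.sum_univ_succAbove _ i, Torus.ins_add_single_self, Torus.ins_add_single_succAbove,
    spinAt_ins, layerEnergy, couplingEnergy, Finset.sum_add_distrib, Finset.mul_sum]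
  abel

/-- The **inter-layer coupling matrix** `K(r, r') = e^{β ∑_y r_y r'_y}` (Schultz–Mattis–Lieb's `V₁`).
[cite: SchultzMattisLieb1964, §II] -/
def couplingMatrix (β : ℝ) : Matrix (Layer d' N) (Layer d' N) ℝ :=
  fun r r' => Real.exp (β * couplingEnergy r r')

/-- The square root of the intra-layer Boltzmann factor, `e^{β E_h(r)/2}`. [cite: SchultzMattisLieb1964, §II] -/
def halfLayerWeight (β h : ℝ) (r : Layer d' N) : ℝ := Real.exp (β * layerEnergy h r / 2)

/-- The **symmetrised transfer matrix** in the direction `e_i`: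
`A(r, r') = e^{βE_h(r)/2} e^{β∑_y r_y r'_y} e^{βE_h(r')/2}` (Schultz–Mattis–Lieb 1964, §II,
`V = V₂^{1/2} V₁ V₂^{1/2}`). [cite: SchultzMattisLieb1964, §II] -/
def transferMatrix (β h : ℝ) : Matrix (Layer d' N) (Layer d' N) ℝ :=
  fun r r' => halfLayerWeight β h r * couplingMatrix β r r' * halfLayerWeight β h r'

/-- `A = D K D` with `D = diag(e^{βE_h/2})`. [cite: SchultzMattisLieb1964, §II] -/
theorem transferMatrix_eq (β h : ℝ) :
    transferMatrix (d' := d') (N := N) β h =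
      diagonal (halfLayerWeight β h) * couplingMatrix β * diagonal (halfLayerWeight β h) := by
  ext r r'
  rw [Matrix.mul_diagonal, Matrix.diagonal_mul]
  simp only [transferMatrix]

/-- `K` is symmetric. [folklore] -/
theorem couplingMatrix_isHermitian (β : ℝ) : (couplingMatrix (d' := d') (N := N) β).IsHermitian := by
  refine Matrix.IsHermitian.ext fun r r' => ?_
  rw [star_trivial, couplingMatrix, couplingMatrix, couplingEnergy_comm]

/-- **High-temperature expansion of the coupling matrix**:
`e^{β ∑_y r_y r'_y} = ∑_S (sinh β)^{|S|} (cosh β)^{|Sᶜ|} r_S r'_S`. [cite: BenettinGallavottiJonaLasinioStella1973, Appendix a), eq. (A.1)] -/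
theorem couplingMatrix_apply_eq_sum (β : ℝ) (r r' : Layer d' N) :
    couplingMatrix β r r' = ∑ S : Finset (TorusSite d' N),
      (Real.sinh β ^ #S * Real.cosh β ^ #(Finset.univ \ S)) * (spinProduct S r * spinProduct S r') := by
  classical
  rw [couplingMatrix, couplingEnergy, Finset.mul_sum, Real.exp_sum]
  have h1 : ∀ y, Real.exp (β * (spinAt y r * spinAt y r')) =
      spinAt y r * spinAt y r' * Real.sinh β + Real.cosh β := by
    intro y
    rw [exp_mul_eq_cosh_add_mul_sinh β (u := spinAt y r * spinAt y r')]
    · ring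
    · rcases spinAt_eq_one_or_eq_neg_one y r with h | h <;>
        rcases spinAt_eq_one_or_eq_neg_one y r' with h' | h' <;> simp [h, h']
  simp_rw [h1]
  rw [Finset.prod_add, Finset.powerset_univ]
  refine Finset.sum_congr rfl fun S _ => ?_
  rw [Finset.prod_mul_distrib, Finset.prod_mul_distrib, Finset.prod_const, Finset.prod_const, spinProduct,
    spinProduct]
  ring

/-- **The coupling matrix is positive semidefinite** for `β ≥ 0`:
`xᵀ K x = ∑_S (sinh β)^{|S|} (cosh β)^{|Sᶜ|} (∑_r x_r r_S)² ≥ 0` (the transfer matrix of the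
nearest-neighbour Ising model is positive: Schultz–Mattis–Lieb 1964, §II; this is the positivity
behind the spectral representation, Glimm–Jaffe 1973). [folklore] -/
theorem couplingMatrix_posSemidef {β : ℝ} (hβ : 0 ≤ β) : (couplingMatrix (d' := d') (N := N) β).PosSemidef := by
  classical
  refine Matrix.PosSemidef.of_dotProduct_mulVec_nonneg (couplingMatrix_isHermitian β) fun x => ?_
  set cS : Finset (TorusSite d' N) → ℝ := fun S => Real.sinh β ^ #S * Real.cosh β ^ #(Finset.univ \ S)
    with hcS
  have hc : ∀ S, 0 ≤ cS S :=
    fun S => mul_nonneg (pow_nonneg (Real.sinh_nonneg_iff.2 hβ) _) (pow_nonneg (Real.cosh_pos β).le _)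
  have hkey : star x ⬝ᵥ (couplingMatrix β *ᵥ x) =
      ∑ S : Finset (TorusSite d' N), cS S * ((∑ r, x r * spinProduct S r) * ∑ r, x r * spinProduct S r) := by
    have e1 : star x ⬝ᵥ (couplingMatrix β *ᵥ x) = ∑ r : Layer d' N, ∑ r' : Layer d' N,
        ∑ S : Finset (TorusSite d' N), x r * x r' * (cS S * (spinProduct S r * spinProduct S r')) := by
      simp only [star_trivial, dotProduct, Matrix.mulVec, Finset.mul_sum]
      refine Finset.sum_congr rfl fun r _ => Finset.sum_congr rfl fun r' _ => ?_
      rw [couplingMatrix_apply_eq_sum, Finset.sum_mul, Finset.mul_sum]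
      refine Finset.sum_congr rfl fun S _ => ?_
      rw [hcS]
      ring
    have e2 : ∑ S : Finset (TorusSite d' N), cS S * ((∑ r, x r * spinProduct S r) * ∑ r, x r * spinProduct S r) =
        ∑ S : Finset (TorusSite d' N), ∑ r : Layer d' N, ∑ r' : Layer d' N,
          x r * x r' * (cS S * (spinProduct S r * spinProduct S r')) := by
      refine Finset.sum_congr rfl fun S _ => ?_
      rw [Finset.sum_mul_sum, Finset.mul_sum]
      refine Finset.sum_congr rfl fun r _ => ?_
      rw [Finset.mul_sum]
      refine Finset.sum_congr rfl fun r' _ => ?_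
      ring
    have e3 : ∀ r : Layer d' N, ∑ r' : Layer d' N, ∑ S : Finset (TorusSite d' N),
        x r * x r' * (cS S * (spinProduct S r * spinProduct S r')) =
        ∑ S : Finset (TorusSite d' N), ∑ r' : Layer d' N, x r * x r' * (cS S * (spinProduct S r * spinProduct S r')) :=
      fun r => Finset.sum_comm
    rw [e1, e2]
    simp only [e3]
    exact Finset.sum_comm
  rw [hkey]
  exact Finset.sum_nonneg fun S _ => mul_nonneg (hc S) (mul_self_nonneg _)

/-- **The symmetrised transfer matrix is positive semidefinite** (`A = D K D`, `D` diagonal).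
[cite: SchultzMattisLieb1964, §II] -/
theorem transferMatrix_posSemidef {β : ℝ} (hβ : 0 ≤ β) (h : ℝ) :
    (transferMatrix (d' := d') (N := N) β h).PosSemidef := by
  have key := (couplingMatrix_posSemidef (d' := d') (N := N) hβ).conjTranspose_mul_mul_same
    (diagonal (halfLayerWeight β h))
  rw [Matrix.diagonal_conjTranspose, show star (halfLayerWeight (d' := d') (N := N) β h) = halfLayerWeight β h
    from funext fun r => star_trivial _] at key
  rwa [transferMatrix_eq]

/-- **Factorisation of the Boltzmann weight along the transfer direction**: for `N ≥ 3`,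
`e^{-βH(σ)} = ∏_s A(r_s, r_{s+1})` with `r = layerOf i σ`. [cite: SchultzMattisLieb1964, §II (Z = ∑∏⟨σ_j|V|σ_{j+1}⟩)] -/
theorem exp_neg_mul_isingHamiltonian_eq_prod (hN : 3 ≤ N) (i : Fin (d' + 1)) (β h : ℝ)
    (σ : SpinConfig (TorusSite (d' + 1) N)) :
    Real.exp (-β * isingHamiltonian (torusGraph (d' + 1) N) Finset.univ h .free σ) =
      ∏ s : ZMod N, transferMatrix β h (layerOf i σ s) (layerOf i σ (s + 1)) := by
  rw [show -β * isingHamiltonian (torusGraph (d' + 1) N) Finset.univ h .free σ =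
      β * -isingHamiltonian (torusGraph (d' + 1) N) Finset.univ h .free σ by ring,
    neg_isingHamiltonian_torus_eq_layers hN i h σ]
  simp only [transferMatrix, halfLayerWeight, couplingMatrix, Finset.prod_mul_distrib]
  have hshift : ∏ s : ZMod N, Real.exp (β * layerEnergy h (layerOf i σ (s + 1)) / 2) =
      ∏ s : ZMod N, Real.exp (β * layerEnergy h (layerOf i σ s) / 2) :=
    Fintype.prod_equiv (Equiv.addRight (1 : ZMod N))
      (fun s => Real.exp (β * layerEnergy h (layerOf i σ (s + 1)) / 2))
      (fun s => Real.exp (β * layerEnergy h (layerOf i σ s) / 2)) (fun _ => rfl)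
  rw [hshift, mul_add, Real.exp_add, Finset.mul_sum, Finset.mul_sum, Real.exp_sum, Real.exp_sum]
  simp only [← Finset.prod_mul_distrib]
  refine Finset.prod_congr rfl fun s _ => ?_
  rw [← Real.exp_add, ← Real.exp_add, ← Real.exp_add]
  congr 1
  ring

end Transfer

section ConfigSum

variable {d' N : ℕ} [NeZero N]

/-- **Configuration sums with two layer observables are two-insertion traces of the transfer matrix**
(Schultz–Mattis–Lieb 1964, §II: `Z = Tr V^M`, `Z⟨σ_{0}σ_{k}⟩ = Tr(σ V^k σ V^{M-k})`; here on the torus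
`(ℤ/Nℤ)^{d'+1}`, `N ≥ 3`, in the direction `e_i`, for arbitrary observables `f, g` of one layer):
`∑_σ e^{-βH(σ)} f(r₀(σ)) g(r_n(σ)) = Tr(diag f · Aⁿ · diag g · A^{N-n})`. [cite: SchultzMattisLieb1964, §II] -/
theorem sum_exp_mul_layerObs_eq_trace (hN : 3 ≤ N) (i : Fin (d' + 1)) (β h : ℝ) (f g : Layer d' N → ℝ)
    (n : ZMod N) :
    ∑ σ : SpinConfig (TorusSite (d' + 1) N),
        Real.exp (-β * isingHamiltonian (torusGraph (d' + 1) N) Finset.univ h .free σ) *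
          (f (layerOf i σ 0) * g (layerOf i σ n)) =
      (diagonal f * transferMatrix β h ^ n.val * diagonal g * transferMatrix β h ^ (N - n.val)).trace := by
  obtain ⟨m, rfl⟩ : ∃ m, N = m + 1 := ⟨N - 1, by have := NeZero.ne N; omega⟩
  rw [← Equiv.sum_comp (layersEquiv i).symm]
  have hlay : ∀ rs : ZMod (m + 1) → Layer d' (m + 1), layerOf i ((layersEquiv i).symm rs) = rs :=
    fun rs => (layersEquiv i).apply_symm_apply rs
  simp only [exp_neg_mul_isingHamiltonian_eq_prod hN i β h, hlay]
  have key := sum_mul_mul_prod_cyclic_eq_trace (transferMatrix (d' := d') (N := m + 1) β h) f g m n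
  calc ∑ rs : ZMod (m + 1) → Layer d' (m + 1),
        (∏ s, transferMatrix β h (rs s) (rs (s + 1))) * (f (rs 0) * g (rs n))
      = ∑ rs : ZMod (m + 1) → Layer d' (m + 1),
          f (rs 0) * g (rs n) * ∏ s, transferMatrix β h (rs s) (rs (s + 1)) :=
        Finset.sum_congr rfl fun rs _ => by ring
    _ = _ := key

end ConfigSum

/-! ### Part 5. The Fourier transform of the torus two-point function in the transfer direction -/

section Fourier

open Complex MeasureTheory
open scoped ComplexConjugate

variable {d' N : ℕ} [NeZero N]

/-- The Boltzmann weight of the periodic model, `w(σ) = e^{-βH(σ)}`. [folklore] -/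
def torusWeight (β h : ℝ) (σ : SpinConfig (TorusSite (d' + 1) N)) : ℝ :=
  Real.exp (-β * isingHamiltonian (torusGraph (d' + 1) N) Finset.univ h .free σ)

/-- **Square completion** (Friedli–Velenik 2017, §10.5.2, display before (10.40), "by translation
invariance `∑_j e^{ip·j}⟨S₀·S_j⟩ = ⟨‖Ŝ_p‖²⟩`"): for the periodic nearest-neighbour Ising model,
`N^{d'+1} Z Ĝ_N(k) = ∑_σ e^{-βH(σ)} |∑_x χ_k(x) σ_x|²`. [cite: FriedliVelenik2017, §10.5.2 (display before (10.40))] -/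
theorem card_mul_Z_mul_twoPointFourierTorus (β h : ℝ) (k : TorusSite (d' + 1) N) :
    ((Fintype.card (TorusSite (d' + 1) N) : ℂ) *
        (isingPartitionFunction (torusGraph (d' + 1) N) Finset.univ β h .free : ℂ)) *
      twoPointFourierTorus (isingTorusMeasure (d' + 1) N β h) k =
    ∑ σ : SpinConfig (TorusSite (d' + 1) N), (torusWeight β h σ : ℂ) *
      ((∑ x, torusChar k x * (spinAt x σ : ℂ)) * conj (∑ x, torusChar k x * (spinAt x σ : ℂ))) := by
  classical
  have hZpos : 0 < isingPartitionFunction (torusGraph (d' + 1) N) Finset.univ β h .free :=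
    isingPartitionFunction_pos _ _ β h _
  have hZ0 : (isingPartitionFunction (torusGraph (d' + 1) N) Finset.univ β h .free : ℂ) ≠ 0 := by
    exact_mod_cast hZpos.ne'
  -- the two-point function as a configuration sum
  have htwo : ∀ x y : TorusSite (d' + 1) N, (torusTwoPoint (isingTorusMeasure (d' + 1) N β h) (y - x) : ℂ) =
      (isingPartitionFunction (torusGraph (d' + 1) N) Finset.univ β h .free : ℂ)⁻¹ *
        ∑ σ : SpinConfig (TorusSite (d' + 1) N), (torusWeight β h σ : ℂ) *
          ((spinAt x σ : ℂ) * (spinAt y σ : ℂ)) := by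
    intro x y
    rw [← isingTorusTwoPoint_eq_torusTwoPoint, isingTorusTwoPoint, isingTwoPoint, isingExpect,
      ← integral_complex_ofReal]
    change ∫ σ, ((spinPair x y σ : ℝ) : ℂ) ∂(isingMeasure (torusGraph (d' + 1) N) Finset.univ β h .free) = _
    rw [integral_isingMeasure_univ_free, Finset.smul_sum]
    simp only [Complex.real_smul, Complex.ofReal_inv, Finset.mul_sum, torusWeight, spinPair,
      Complex.ofReal_mul]
  -- `N^{d'+1} Ĝ(k) = ∑_{x,y} G(y-x) χ(x) conj χ(y)`
  have hsum : (Fintype.card (TorusSite (d' + 1) N) : ℂ) * twoPointFourierTorus (isingTorusMeasure (d' + 1) N β h) k =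
      ∑ x : TorusSite (d' + 1) N, ∑ y : TorusSite (d' + 1) N,
        (torusTwoPoint (isingTorusMeasure (d' + 1) N β h) (y - x) : ℂ) * (torusChar k x * conj (torusChar k y)) := by
    rw [twoPointFourierTorus, torusFourier_eq_sum_torusChar]
    have : ∀ x : TorusSite (d' + 1) N,
        ∑ y, (torusTwoPoint (isingTorusMeasure (d' + 1) N β h) (y - x) : ℂ) * (torusChar k x * conj (torusChar k y)) =
        ∑ z, (torusTwoPoint (isingTorusMeasure (d' + 1) N β h) z : ℂ) * conj (torusChar k z) := by
      intro x
      rw [← Equiv.sum_comp (Equiv.addRight x)]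
      refine Finset.sum_congr rfl fun z _ => ?_
      simp only [Equiv.coe_addRight, add_sub_cancel_right]
      rw [torusChar_add_right, map_mul]
      calc (torusTwoPoint (isingTorusMeasure (d' + 1) N β h) z : ℂ) *
            (torusChar k x * (conj (torusChar k z) * conj (torusChar k x)))
          = (torusTwoPoint (isingTorusMeasure (d' + 1) N β h) z : ℂ) * conj (torusChar k z) *
              (torusChar k x * conj (torusChar k x)) := by ring
        _ = _ := by rw [torusChar_mul_conj, mul_one]
    simp only [this, Finset.sum_const, Finset.card_univ, nsmul_eq_mul]
  -- square completion
  have hsq : ∀ σ : SpinConfig (TorusSite (d' + 1) N),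
      (torusWeight β h σ : ℂ) * ((∑ x, torusChar k x * (spinAt x σ : ℂ)) * conj (∑ x, torusChar k x * (spinAt x σ : ℂ))) =
      ∑ x : TorusSite (d' + 1) N, ∑ y : TorusSite (d' + 1) N,
        (torusWeight β h σ : ℂ) * ((spinAt x σ : ℂ) * (spinAt y σ : ℂ)) * (torusChar k x * conj (torusChar k y)) := by
    intro σ
    rw [map_sum, Finset.sum_mul_sum, Finset.mul_sum]
    refine Finset.sum_congr rfl fun x _ => ?_
    rw [Finset.mul_sum]
    refine Finset.sum_congr rfl fun y _ => ?_
    rw [map_mul, Complex.conj_ofReal]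
    ring
  calc ((Fintype.card (TorusSite (d' + 1) N) : ℂ) *
        (isingPartitionFunction (torusGraph (d' + 1) N) Finset.univ β h .free : ℂ)) *
          twoPointFourierTorus (isingTorusMeasure (d' + 1) N β h) k
      = (isingPartitionFunction (torusGraph (d' + 1) N) Finset.univ β h .free : ℂ) *
          ∑ x : TorusSite (d' + 1) N, ∑ y : TorusSite (d' + 1) N,
            (torusTwoPoint (isingTorusMeasure (d' + 1) N β h) (y - x) : ℂ) * (torusChar k x * conj (torusChar k y)) := by
        rw [← hsum]; ring
    _ = ∑ x : TorusSite (d' + 1) N, ∑ y : TorusSite (d' + 1) N,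
          ∑ σ : SpinConfig (TorusSite (d' + 1) N), (torusWeight β h σ : ℂ) *
            ((spinAt x σ : ℂ) * (spinAt y σ : ℂ)) * (torusChar k x * conj (torusChar k y)) := by
        rw [Finset.mul_sum]
        refine Finset.sum_congr rfl fun x _ => ?_
        rw [Finset.mul_sum]
        refine Finset.sum_congr rfl fun y _ => ?_
        rw [htwo, ← mul_assoc, ← mul_assoc, ← mul_assoc, mul_inv_cancel₀ hZ0, one_mul, Finset.sum_mul,
          Finset.sum_mul]
        exact Finset.sum_congr rfl fun σ _ => by ring
    _ = ∑ σ : SpinConfig (TorusSite (d' + 1) N), ∑ x : TorusSite (d' + 1) N, ∑ y : TorusSite (d' + 1) N,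
          (torusWeight β h σ : ℂ) * ((spinAt x σ : ℂ) * (spinAt y σ : ℂ)) * (torusChar k x * conj (torusChar k y)) := by
        have e1 : ∀ x : TorusSite (d' + 1) N, ∑ y : TorusSite (d' + 1) N,
            ∑ σ : SpinConfig (TorusSite (d' + 1) N), (torusWeight β h σ : ℂ) *
              ((spinAt x σ : ℂ) * (spinAt y σ : ℂ)) * (torusChar k x * conj (torusChar k y)) =
            ∑ σ : SpinConfig (TorusSite (d' + 1) N), ∑ y : TorusSite (d' + 1) N, (torusWeight β h σ : ℂ) *
              ((spinAt x σ : ℂ) * (spinAt y σ : ℂ)) * (torusChar k x * conj (torusChar k y)) :=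
          fun x => Finset.sum_comm
        simp only [e1]
        exact Finset.sum_comm
    _ = _ := by simp only [hsq]

/-! #### Splitting the character along the transfer direction -/

/-- The smeared layer observable `Ψ_s(σ) = ∑_y χ_{k⊥}(y) σ_{ins_i(s,y)}` (the spin-wave mode of the
layer `s` at transverse momentum `k⊥ = i.removeNth k`). [cite: AizenmanDuminilCopinAnnals2021, arXiv:1912.07973 §5.2–5.3 (spin-wave modes, v_{p⊥})] -/
def layerMode (i : Fin (d' + 1)) (k : TorusSite (d' + 1) N) (σ : SpinConfig (TorusSite (d' + 1) N))
    (s : ZMod N) : ℂ :=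
  ∑ y : TorusSite d' N, torusChar (i.removeNth k) y * (spinAt y (layerOf i σ s) : ℂ)

omit [NeZero N] in
/-- A translation in the transfer direction: `ins_i(s, y) + t e_i = ins_i(s + t, y)`. [folklore] -/
theorem Torus.ins_add_single (i : Fin (d' + 1)) (s t : ZMod N) (y : TorusSite d' N) :
    Torus.ins i s y + Pi.single i t = Torus.ins i (s + t) y := by
  funext x
  refine Fin.succAboveCases i ?_ (fun j => ?_) x
  · simp
  · simp [Fin.succAbove_ne]

/-- The character splits along `i`: `χ_k(ins_i(s, y)) = e(k_i s) χ_{k⊥}(y)`. [folklore] -/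
theorem torusChar_ins (i : Fin (d' + 1)) (k : TorusSite (d' + 1) N) (s : ZMod N) (y : TorusSite d' N) :
    torusChar k (Torus.ins i s y) = ZMod.stdAddChar (k i * s) * torusChar (i.removeNth k) y := by
  unfold torusChar
  rw [Fin.prod_univ_succAbove _ i, Torus.ins_apply_same]
  congr 1
  refine Finset.prod_congr rfl fun j _ => ?_
  rw [Torus.ins_apply_succAbove]
  rfl

/-- The total spin-wave mode splits into layer modes: `∑_x χ_k(x) σ_x = ∑_s e(k_i s) Ψ_s(σ)`. [folklore] -/
theorem sum_torusChar_mul_spinAt_eq (i : Fin (d' + 1)) (k : TorusSite (d' + 1) N)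
    (σ : SpinConfig (TorusSite (d' + 1) N)) :
    ∑ x, torusChar k x * (spinAt x σ : ℂ) = ∑ s : ZMod N, ZMod.stdAddChar (k i * s) * layerMode i k σ s := by
  rw [sum_torus_eq_sum_sum i]
  refine Finset.sum_congr rfl fun s _ => ?_
  rw [layerMode, Finset.mul_sum]
  refine Finset.sum_congr rfl fun y _ => ?_
  rw [torusChar_ins, spinAt_ins, mul_assoc]

/-- **Invariance of weighted configuration sums under graph automorphisms** (the periodic Gibbs
weight is invariant, `isingHamiltonian_univ_free_comp_equiv`, and `σ ↦ σ ∘ θ` is a bijection of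
configurations). [cite: FriedliVelenik2017, §10.3.1 eq. (10.2)] -/
theorem sum_torusWeight_mul_comp_equiv (β h : ℝ) (θ : TorusSite (d' + 1) N ≃ TorusSite (d' + 1) N)
    (hθ : ∀ x y, (torusGraph (d' + 1) N).Adj (θ x) (θ y) ↔ (torusGraph (d' + 1) N).Adj x y)
    (F : SpinConfig (TorusSite (d' + 1) N) → ℂ) :
    ∑ σ : SpinConfig (TorusSite (d' + 1) N), (torusWeight β h σ : ℂ) * F (σ ∘ θ) =
      ∑ σ : SpinConfig (TorusSite (d' + 1) N), (torusWeight β h σ : ℂ) * F σ := by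
  have hw : ∀ σ : SpinConfig (TorusSite (d' + 1) N), torusWeight β h (σ ∘ θ) = torusWeight β h σ := by
    intro σ
    simp only [torusWeight, isingHamiltonian_univ_free_comp_equiv _ θ hθ]
  calc ∑ σ : SpinConfig (TorusSite (d' + 1) N), (torusWeight β h σ : ℂ) * F (σ ∘ θ)
      = ∑ σ : SpinConfig (TorusSite (d' + 1) N), (torusWeight β h (σ ∘ θ) : ℂ) * F (σ ∘ θ) := by
        simp only [hw]
    _ = ∑ σ : SpinConfig (TorusSite (d' + 1) N), (torusWeight β h σ : ℂ) * F σ :=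
        Equiv.sum_comp (Equiv.arrowCongr θ.symm (Equiv.refl ℤˣ)) (fun σ => (torusWeight β h σ : ℂ) * F σ)

/-- Layer modes under a translation `x ↦ x + t e_i`: `Ψ_s(σ ∘ τ_t) = Ψ_{s+t}(σ)`. [folklore] -/
theorem layerMode_comp_addRight (i : Fin (d' + 1)) (k : TorusSite (d' + 1) N)
    (σ : SpinConfig (TorusSite (d' + 1) N)) (s t : ZMod N) :
    layerMode i k (σ ∘ Equiv.addRight (Pi.single i t)) s = layerMode i k σ (s + t) := by
  unfold layerMode
  refine Finset.sum_congr rfl fun y _ => ?_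
  congr 2
  simp only [spinAt, layerOf, Function.comp_apply, Equiv.coe_addRight, Torus.ins_add_single]

/-- **Stationarity in the transfer direction**: `∑_σ w Ψ_s conj Ψ_t = ∑_σ w Ψ_{s-t} conj Ψ_0`. [folklore] -/
theorem sum_torusWeight_layerMode_mul_conj (β h : ℝ) (i : Fin (d' + 1)) (k : TorusSite (d' + 1) N)
    (s t : ZMod N) :
    ∑ σ : SpinConfig (TorusSite (d' + 1) N), (torusWeight β h σ : ℂ) *
        (layerMode i k σ s * conj (layerMode i k σ t)) =
      ∑ σ : SpinConfig (TorusSite (d' + 1) N), (torusWeight β h σ : ℂ) *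
        (layerMode i k σ (s - t) * conj (layerMode i k σ 0)) := by
  rw [← sum_torusWeight_mul_comp_equiv β h (Equiv.addRight (Pi.single i (-t)))
    (fun x y => torusGraph_adj_add_right _ x y)]
  refine Finset.sum_congr rfl fun σ _ => ?_
  simp only [layerMode_comp_addRight, ← sub_eq_add_neg, sub_self]

/-- `e(k_i s) conj e(k_i t) = e(k_i (s - t))`. [folklore] -/
theorem stdAddChar_mul_conj_eq (a s t : ZMod N) :
    ZMod.stdAddChar (a * s) * conj (ZMod.stdAddChar (a * t)) = (ZMod.stdAddChar (a * (s - t)) : ℂ) := by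
  rw [← AddChar.map_neg_eq_conj, ← AddChar.map_add_eq_mul]
  congr 1
  ring

/-- **The Fourier transform in the transfer direction** (Aizenman–Duminil-Copin 2021, §5.3, proof of
Prop. 5.3 / Appendix; Panis 2023, proof of Thm 3.13): with `Ψ_s` the layer modes,
`N^{d'} Z Ĝ_N(k) = ∑_{n ∈ ℤ/Nℤ} e(k_i n) · ∑_σ e^{-βH(σ)} Ψ_n(σ) conj Ψ_0(σ)`.
[cite: AizenmanDuminilCopinAnnals2021, arXiv:1912.07973 Prop. 5.3 and its proof (Appendix A)] -/
theorem cardLayer_mul_Z_mul_twoPointFourierTorus (β h : ℝ) (i : Fin (d' + 1)) (k : TorusSite (d' + 1) N) :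
    ((Fintype.card (TorusSite d' N) : ℂ) *
        (isingPartitionFunction (torusGraph (d' + 1) N) Finset.univ β h .free : ℂ)) *
      twoPointFourierTorus (isingTorusMeasure (d' + 1) N β h) k =
    ∑ n : ZMod N, ZMod.stdAddChar (k i * n) *
      ∑ σ : SpinConfig (TorusSite (d' + 1) N), (torusWeight β h σ : ℂ) *
        (layerMode i k σ n * conj (layerMode i k σ 0)) := by
  classical
  have hcard : (Fintype.card (TorusSite (d' + 1) N) : ℂ) = (N : ℂ) * Fintype.card (TorusSite d' N) := by
    rw [Fintype.card_congr (Torus.splitEquiv i).symm, Fintype.card_prod, ZMod.card]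
    push_cast
    ring
  have hN0 : (N : ℂ) ≠ 0 := by exact_mod_cast NeZero.ne N
  have key := card_mul_Z_mul_twoPointFourierTorus (d' := d') (N := N) β h k
  rw [hcard] at key
  -- expand `Φ conj Φ` by layers and use stationarity
  have hexp : ∀ σ : SpinConfig (TorusSite (d' + 1) N),
      (∑ x, torusChar k x * (spinAt x σ : ℂ)) * conj (∑ x, torusChar k x * (spinAt x σ : ℂ)) =
      ∑ s : ZMod N, ∑ t : ZMod N, ZMod.stdAddChar (k i * (s - t)) *
        (layerMode i k σ s * conj (layerMode i k σ t)) := by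
    intro σ
    rw [sum_torusChar_mul_spinAt_eq i, map_sum, Finset.sum_mul_sum]
    refine Finset.sum_congr rfl fun s _ => Finset.sum_congr rfl fun t _ => ?_
    rw [map_mul (starRingEnd ℂ), ← stdAddChar_mul_conj_eq]
    ring
  have h1 : ∑ σ : SpinConfig (TorusSite (d' + 1) N), (torusWeight β h σ : ℂ) *
      ((∑ x, torusChar k x * (spinAt x σ : ℂ)) * conj (∑ x, torusChar k x * (spinAt x σ : ℂ))) =
      ∑ s : ZMod N, ∑ t : ZMod N, ZMod.stdAddChar (k i * (s - t)) *
        ∑ σ : SpinConfig (TorusSite (d' + 1) N), (torusWeight β h σ : ℂ) *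
          (layerMode i k σ (s - t) * conj (layerMode i k σ 0)) := by
    simp only [hexp, Finset.mul_sum]
    rw [Finset.sum_comm]
    refine Finset.sum_congr rfl fun s _ => ?_
    rw [Finset.sum_comm]
    refine Finset.sum_congr rfl fun t _ => ?_
    rw [← Finset.mul_sum, ← sum_torusWeight_layerMode_mul_conj β h i k s t, Finset.mul_sum]
    exact Finset.sum_congr rfl fun σ _ => by ring
  have h2 : ∑ s : ZMod N, ∑ t : ZMod N, ZMod.stdAddChar (k i * (s - t)) *
        ∑ σ : SpinConfig (TorusSite (d' + 1) N), (torusWeight β h σ : ℂ) *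
          (layerMode i k σ (s - t) * conj (layerMode i k σ 0)) =
      (N : ℂ) * ∑ n : ZMod N, ZMod.stdAddChar (k i * n) *
        ∑ σ : SpinConfig (TorusSite (d' + 1) N), (torusWeight β h σ : ℂ) *
          (layerMode i k σ n * conj (layerMode i k σ 0)) := by
    rw [Finset.sum_comm]
    have : ∀ t : ZMod N, ∑ s : ZMod N, ZMod.stdAddChar (k i * (s - t)) *
        ∑ σ : SpinConfig (TorusSite (d' + 1) N), (torusWeight β h σ : ℂ) *
          (layerMode i k σ (s - t) * conj (layerMode i k σ 0)) =
        ∑ n : ZMod N, ZMod.stdAddChar (k i * n) *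
          ∑ σ : SpinConfig (TorusSite (d' + 1) N), (torusWeight β h σ : ℂ) *
            (layerMode i k σ n * conj (layerMode i k σ 0)) :=
      fun t => Fintype.sum_equiv (Equiv.subRight t) _ _ (fun s => rfl)
    simp only [this, Finset.sum_const, Finset.card_univ, ZMod.card, nsmul_eq_mul]
  rw [h1, h2] at key
  refine mul_left_cancel₀ hN0 ?_
  rw [← key]
  ring

end Fourier

/-! #### The layer correlations as two-insertion traces -/

section Traces

open Complex
open scoped ComplexConjugate

variable {d' N : ℕ} [NeZero N]

/-- The cosine part of the layer mode, a real observable of one layer: `C(r) = ∑_y Re χ_{k⊥}(y) r_y`. [folklore] -/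
def layerObsRe (kp : TorusSite d' N) (r : Layer d' N) : ℝ := ∑ y, (torusChar kp y).re * spinAt y r

/-- The sine part of the layer mode: `S(r) = ∑_y Im χ_{k⊥}(y) r_y`. [folklore] -/
def layerObsIm (kp : TorusSite d' N) (r : Layer d' N) : ℝ := ∑ y, (torusChar kp y).im * spinAt y r

/-- `Ψ_s(σ) = C(r_s) + i S(r_s)`. [folklore] -/
theorem layerMode_eq (i : Fin (d' + 1)) (k : TorusSite (d' + 1) N) (σ : SpinConfig (TorusSite (d' + 1) N))
    (s : ZMod N) :
    layerMode i k σ s = (layerObsRe (i.removeNth k) (layerOf i σ s) : ℂ) +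
      (layerObsIm (i.removeNth k) (layerOf i σ s) : ℂ) * I := by
  rw [layerMode, layerObsRe, layerObsIm]
  push_cast
  rw [Finset.sum_mul, ← Finset.sum_add_distrib]
  refine Finset.sum_congr rfl fun y _ => ?_
  rw [← Complex.re_add_im (torusChar (i.removeNth k) y)]
  simp only [Complex.add_re, Complex.ofReal_re, Complex.mul_re, Complex.I_re, mul_zero, Complex.ofReal_im,
    Complex.I_im, mul_one, sub_self, add_zero, Complex.add_im, Complex.mul_im, zero_add]
  ring

/-- **Symmetry of two-insertion traces** for a symmetric matrix:
`Tr(diag f Aⁿ diag g Aᵐ) = Tr(diag g Aⁿ diag f Aᵐ)` (transpose and cyclicity). [folklore] -/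
theorem trace_diagonal_pow_comm {ι : Type*} [Fintype ι] [DecidableEq ι] {A : Matrix ι ι ℝ}
    (hA : A.transpose = A) (f g : ι → ℝ) (n m : ℕ) :
    (diagonal f * A ^ n * diagonal g * A ^ m).trace = (diagonal g * A ^ n * diagonal f * A ^ m).trace := by
  conv_lhs => rw [← Matrix.trace_transpose]
  rw [Matrix.transpose_mul, Matrix.transpose_mul, Matrix.transpose_mul, Matrix.transpose_pow,
    Matrix.transpose_pow, hA, diagonal_transpose, diagonal_transpose]
  rw [show A ^ m * (diagonal g * ((A ^ n) * diagonal f)) = A ^ m * (diagonal g * A ^ n * diagonal f) by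
    simp only [Matrix.mul_assoc], Matrix.trace_mul_comm]

/-- The transfer matrix is symmetric. [folklore] -/
theorem transferMatrix_transpose (β h : ℝ) :
    (transferMatrix (d' := d') (N := N) β h).transpose = transferMatrix β h := by
  ext r r'
  simp only [Matrix.transpose_apply, transferMatrix, couplingMatrix, couplingEnergy_comm r' r]
  ring

/-- **The layer correlation in the transfer direction is a sum of two two-insertion traces**
(Schultz–Mattis–Lieb 1964, §II; the imaginary cross terms cancel by the symmetry of the transfer
matrix): for `N ≥ 3`,
`∑_σ e^{-βH(σ)} Ψ_n(σ) conj Ψ_0(σ) = Tr(D_C Aⁿ D_C A^{N-n}) + Tr(D_S Aⁿ D_S A^{N-n})`, a real number,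
with `D_C = diag C`, `D_S = diag S` the cosine and sine parts of the layer mode. [cite: SchultzMattisLieb1964, §II] -/
theorem sum_torusWeight_layerMode_conj_eq_trace (hN : 3 ≤ N) (β h : ℝ) (i : Fin (d' + 1))
    (k : TorusSite (d' + 1) N) (n : ZMod N) :
    ∑ σ : SpinConfig (TorusSite (d' + 1) N), (torusWeight β h σ : ℂ) *
        (layerMode i k σ n * conj (layerMode i k σ 0)) =
      (((diagonal (layerObsRe (i.removeNth k)) * transferMatrix β h ^ n.val *
            diagonal (layerObsRe (i.removeNth k)) * transferMatrix β h ^ (N - n.val)).trace +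
        (diagonal (layerObsIm (i.removeNth k)) * transferMatrix β h ^ n.val *
            diagonal (layerObsIm (i.removeNth k)) * transferMatrix β h ^ (N - n.val)).trace : ℝ) : ℂ) := by
  set C := layerObsRe (i.removeNth k) with hC
  set S := layerObsIm (i.removeNth k) with hS
  set A := transferMatrix (d' := d') (N := N) β h with hA
  have hCC := sum_exp_mul_layerObs_eq_trace hN i β h C C n
  have hSS := sum_exp_mul_layerObs_eq_trace hN i β h S S n
  have hCS := sum_exp_mul_layerObs_eq_trace hN i β h C S n
  have hSC := sum_exp_mul_layerObs_eq_trace hN i β h S C n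
  have hsym : (diagonal C * A ^ n.val * diagonal S * A ^ (N - n.val)).trace =
      (diagonal S * A ^ n.val * diagonal C * A ^ (N - n.val)).trace :=
    trace_diagonal_pow_comm (transferMatrix_transpose β h) C S _ _
  -- expand the complex product into four real configuration sums
  have hexp : ∀ σ : SpinConfig (TorusSite (d' + 1) N),
      (torusWeight β h σ : ℂ) * (layerMode i k σ n * conj (layerMode i k σ 0)) =
        ((torusWeight β h σ * (C (layerOf i σ 0) * C (layerOf i σ n)) +
            torusWeight β h σ * (S (layerOf i σ 0) * S (layerOf i σ n)) : ℝ) : ℂ) +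
          ((torusWeight β h σ * (C (layerOf i σ 0) * S (layerOf i σ n)) -
            torusWeight β h σ * (S (layerOf i σ 0) * C (layerOf i σ n)) : ℝ) : ℂ) * I := by
    intro σ
    rw [layerMode_eq, layerMode_eq, map_add, map_mul (starRingEnd ℂ), Complex.conj_ofReal, Complex.conj_ofReal,
      Complex.conj_I]
    push_cast
    ring_nf
    rw [Complex.I_sq]
    ring
  rw [Finset.sum_congr rfl (fun σ _ => hexp σ), Finset.sum_add_distrib, ← Finset.sum_mul, ← Complex.ofReal_sum,
    ← Complex.ofReal_sum, Finset.sum_add_distrib, Finset.sum_sub_distrib]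
  have e1 : ∑ σ : SpinConfig (TorusSite (d' + 1) N), torusWeight β h σ * (C (layerOf i σ 0) * C (layerOf i σ n)) =
      (diagonal C * A ^ n.val * diagonal C * A ^ (N - n.val)).trace := hCC
  have e2 : ∑ σ : SpinConfig (TorusSite (d' + 1) N), torusWeight β h σ * (S (layerOf i σ 0) * S (layerOf i σ n)) =
      (diagonal S * A ^ n.val * diagonal S * A ^ (N - n.val)).trace := hSS
  have e3 : ∑ σ : SpinConfig (TorusSite (d' + 1) N), torusWeight β h σ * (C (layerOf i σ 0) * S (layerOf i σ n)) =
      (diagonal C * A ^ n.val * diagonal S * A ^ (N - n.val)).trace := hCS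
  have e4 : ∑ σ : SpinConfig (TorusSite (d' + 1) N), torusWeight β h σ * (S (layerOf i σ 0) * C (layerOf i σ n)) =
      (diagonal S * A ^ n.val * diagonal C * A ^ (N - n.val)).trace := hSC
  rw [e1, e2, e3, e4, hsym, sub_self]
  push_cast
  simp

end Traces

/-! ### Part 6. Assembly: the spectral profile of `Ĝ_N` in one coordinate, and the monotonicity theorems -/

section Assembly

open Complex
open scoped ComplexConjugate

variable {d' N : ℕ} [NeZero N]

/-- `e(a n) = e(a)^{n.val}`. [folklore] -/
theorem stdAddChar_mul_eq_pow (a n : ZMod N) : (ZMod.stdAddChar (a * n) : ℂ) = (ZMod.stdAddChar a : ℂ) ^ n.val := by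
  conv_lhs => rw [← ZMod.natCast_zmod_val n]
  rw [mul_comm, ← nsmul_eq_mul, AddChar.map_nsmul_eq_pow]

/-- `e(a)^N = 1`. [folklore] -/
theorem stdAddChar_pow_card (a : ZMod N) : (ZMod.stdAddChar a : ℂ) ^ N = 1 := by
  rw [← AddChar.map_nsmul_eq_pow, nsmul_eq_mul, ZMod.natCast_self, zero_mul, AddChar.map_zero_eq_one]

/-- `|e(a)| = 1`. [folklore] -/
theorem norm_stdAddChar (a : ZMod N) : ‖(ZMod.stdAddChar a : ℂ)‖ = 1 := by
  rw [ZMod.stdAddChar_apply]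
  exact Circle.norm_coe _

/-- `Re e(a) = cos (2π a / N)`. [folklore] -/
theorem stdAddChar_re (a : ZMod N) : (ZMod.stdAddChar a : ℂ).re = Real.cos (2 * Real.pi * a.val / N) := by
  rw [ZMod.stdAddChar_apply, ZMod.toCircle_apply]
  have : (2 * (Real.pi : ℂ) * I * (a.val : ℂ) / (N : ℂ)) = ((2 * Real.pi * a.val / N : ℝ) : ℂ) * I := by
    push_cast
    ring
  rw [this, Complex.exp_ofReal_mul_I_re]

/-- Sums over `ℤ/Nℤ` through the representatives `0, …, N-1`. [folklore] -/
theorem sum_zmod_val_eq_sum_range {M : Type*} [AddCommMonoid M] (F : ℕ → M) :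
    ∑ n : ZMod N, F n.val = ∑ m ∈ Finset.range N, F m := by
  obtain ⟨M', hM'⟩ : ∃ m, N = m + 1 := ⟨N - 1, by have := NeZero.ne N; omega⟩
  subst hM'
  exact Fin.sum_univ_eq_sum_range F (M' + 1)

/-- **The spectral profile of `Ĝ_N` along one coordinate** (Glimm–Jaffe 1973; Aizenman–Duminil-Copin
2021, Prop. 5.3–5.4; Panis 2023, Thm 3.13 / Cor. 3.15 — here the exact finite-volume statement on
the torus `(ℤ/Nℤ)^{d'+1}`, `N ≥ 3`, `β ≥ 0`, any field `h`): for a fixed direction `i` and fixed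
transverse momentum `k⊥`, there is a function `ρ ≥ 0` of `u = 1 - cos p_i ∈ [0, 2]`, antitone, with
`u ρ(u)` monotone — a nonnegative combination of Lorentzians `P/((λ-μ)² + 2λμ u)` in `u` and a point
mass at `u = 0`, coming from the spectral decomposition of the positive transfer matrix — such that
`|Λ^{(d')}| Z · Ĝ_N(k) = ρ(1 - cos (2π k_i/N))` for every `k` with `i.removeNth k = k⊥`.
[cite: AizenmanDuminilCopinAnnals2021, arXiv:1912.07973 Prop. 5.3 and Prop. 5.4 (i),(ii) (p. 17–18)] [cite: Panis2023Triviality, Thm. 3.13 and Cor. 3.15] -/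
theorem exists_spectralProfile (hN : 3 ≤ N) {β : ℝ} (hβ : 0 ≤ β) (h : ℝ) (i : Fin (d' + 1))
    (kp : TorusSite d' N) :
    ∃ ρ : ℝ → ℝ, (∀ u, 0 ≤ u → 0 ≤ ρ u) ∧ (∀ u u', 0 ≤ u → u ≤ u' → ρ u' ≤ ρ u) ∧
      (∀ u u', 0 ≤ u → u ≤ u' → u * ρ u ≤ u' * ρ u') ∧
      ∀ k : TorusSite (d' + 1) N, i.removeNth k = kp →
        (((Fintype.card (TorusSite d' N) : ℝ) *
            isingPartitionFunction (torusGraph (d' + 1) N) Finset.univ β h .free : ℝ) : ℂ) *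
          twoPointFourierTorus (isingTorusMeasure (d' + 1) N β h) k =
        (ρ (1 - Real.cos (2 * Real.pi * (k i).val / N)) : ℂ) := by
  classical
  have hA := transferMatrix_posSemidef (d' := d') (N := N) hβ h
  obtain ⟨evC, cC, hevC, hcC0, hcCsym, hC⟩ := trace_diagonal_pow_diagonal_pow_eq_sum hA (layerObsRe kp)
  obtain ⟨evS, cS, hevS, hcS0, hcSsym, hS⟩ := trace_diagonal_pow_diagonal_pow_eq_sum hA (layerObsIm kp)
  refine ⟨fun u => (1 / 2) * ∑ a, ∑ b, cC a b * pairKernel N (evC a) (evC b) u +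
    (1 / 2) * ∑ a, ∑ b, cS a b * pairKernel N (evS a) (evS b) u, ?_, ?_, ?_, ?_⟩
  · intro u hu
    have h1 : 0 ≤ ∑ a, ∑ b, cC a b * pairKernel N (evC a) (evC b) u :=
      Finset.sum_nonneg fun a _ => Finset.sum_nonneg fun b _ =>
        mul_nonneg (hcC0 a b) (pairKernel_nonneg N (hevC a) (hevC b) hu)
    have h2 : 0 ≤ ∑ a, ∑ b, cS a b * pairKernel N (evS a) (evS b) u :=
      Finset.sum_nonneg fun a _ => Finset.sum_nonneg fun b _ =>
        mul_nonneg (hcS0 a b) (pairKernel_nonneg N (hevS a) (hevS b) hu)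
    positivity
  · intro u u' hu huu'
    have h1 : ∑ a, ∑ b, cC a b * pairKernel N (evC a) (evC b) u' ≤ ∑ a, ∑ b, cC a b * pairKernel N (evC a) (evC b) u :=
      Finset.sum_le_sum fun a _ => Finset.sum_le_sum fun b _ =>
        mul_le_mul_of_nonneg_left (pairKernel_antitone N (hevC a) (hevC b) hu huu') (hcC0 a b)
    have h2 : ∑ a, ∑ b, cS a b * pairKernel N (evS a) (evS b) u' ≤ ∑ a, ∑ b, cS a b * pairKernel N (evS a) (evS b) u :=
      Finset.sum_le_sum fun a _ => Finset.sum_le_sum fun b _ =>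
        mul_le_mul_of_nonneg_left (pairKernel_antitone N (hevS a) (hevS b) hu huu') (hcS0 a b)
    linarith
  · intro u u' hu huu'
    have h1 : u * ∑ a, ∑ b, cC a b * pairKernel N (evC a) (evC b) u ≤
        u' * ∑ a, ∑ b, cC a b * pairKernel N (evC a) (evC b) u' := by
      rw [Finset.mul_sum, Finset.mul_sum]
      refine Finset.sum_le_sum fun a _ => ?_
      rw [Finset.mul_sum, Finset.mul_sum]
      refine Finset.sum_le_sum fun b _ => ?_
      have := mul_le_mul_of_nonneg_left (mul_pairKernel_monotone N (hevC a) (hevC b) hu huu') (hcC0 a b)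
      nlinarith [this]
    have h2 : u * ∑ a, ∑ b, cS a b * pairKernel N (evS a) (evS b) u ≤
        u' * ∑ a, ∑ b, cS a b * pairKernel N (evS a) (evS b) u' := by
      rw [Finset.mul_sum, Finset.mul_sum]
      refine Finset.sum_le_sum fun a _ => ?_
      rw [Finset.mul_sum, Finset.mul_sum]
      refine Finset.sum_le_sum fun b _ => ?_
      have := mul_le_mul_of_nonneg_left (mul_pairKernel_monotone N (hevS a) (hevS b) hu huu') (hcS0 a b)
      nlinarith [this]
    nlinarith [h1, h2]
  · intro k hk
    have hωN : (ZMod.stdAddChar (k i) : ℂ) ^ N = 1 := stdAddChar_pow_card (k i)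
    have hω1 : ‖(ZMod.stdAddChar (k i) : ℂ)‖ = 1 := norm_stdAddChar (k i)
    have hωre : (ZMod.stdAddChar (k i) : ℂ).re = Real.cos (2 * Real.pi * (k i).val / N) := stdAddChar_re (k i)
    have hprod : (((Fintype.card (TorusSite d' N) : ℝ) *
        isingPartitionFunction (torusGraph (d' + 1) N) Finset.univ β h .free : ℝ) : ℂ) =
        (Fintype.card (TorusSite d' N) : ℂ) *
          (isingPartitionFunction (torusGraph (d' + 1) N) Finset.univ β h .free : ℂ) := by
      push_cast; ring
    rw [hprod, cardLayer_mul_Z_mul_twoPointFourierTorus β h i k]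
    simp only [sum_torusWeight_layerMode_conj_eq_trace hN β h i k, hk, stdAddChar_mul_eq_pow]
    simp only [hC, hS, Complex.ofReal_add, mul_add, Finset.sum_add_distrib]
    have eC : ∑ n : ZMod N, (ZMod.stdAddChar (k i) : ℂ) ^ n.val *
        ((∑ a, ∑ b, cC a b * (evC b ^ n.val * evC a ^ (N - n.val)) : ℝ) : ℂ) =
        (((1 / 2 : ℝ) * ∑ a, ∑ b, cC a b * pairKernel N (evC a) (evC b) (1 - (ZMod.stdAddChar (k i) : ℂ).re) : ℝ) : ℂ) :=
      (sum_zmod_val_eq_sum_range _).trans (sum_pow_mul_spectralSum_eq hωN hω1 hevC hcCsym)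
    have eS : ∑ n : ZMod N, (ZMod.stdAddChar (k i) : ℂ) ^ n.val *
        ((∑ a, ∑ b, cS a b * (evS b ^ n.val * evS a ^ (N - n.val)) : ℝ) : ℂ) =
        (((1 / 2 : ℝ) * ∑ a, ∑ b, cS a b * pairKernel N (evS a) (evS b) (1 - (ZMod.stdAddChar (k i) : ℂ).re) : ℝ) : ℂ) :=
      (sum_zmod_val_eq_sum_range _).trans (sum_pow_mul_spectralSum_eq hωN hω1 hevS hcSsym)
    rw [eC, eS, hωre]

/-- **`Ĝ_N(k) ≥ 0`** (the Fourier transform of the periodic two-point function is a positive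
combination of Lorentzians; Fröhlich–Simon–Spencer 1976, §3; Glimm–Jaffe 1973). For the
nearest-neighbour Ising model on `(ℤ/Nℤ)^{d'+1}`, `N ≥ 3`, `β ≥ 0`, any field. [cite: FrohlichSimonSpencer1976, §3] -/
theorem twoPointFourierTorus_re_nonneg (hN : 3 ≤ N) {β : ℝ} (hβ : 0 ≤ β) (h : ℝ)
    (k : TorusSite (d' + 1) N) : 0 ≤ (twoPointFourierTorus (isingTorusMeasure (d' + 1) N β h) k).re := by
  obtain ⟨ρ, hρ0, -, -, hrep⟩ := exists_spectralProfile hN hβ h (0 : Fin (d' + 1)) ((0 : Fin (d' + 1)).removeNth k)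
  have hpos : 0 < (Fintype.card (TorusSite d' N) : ℝ) *
      isingPartitionFunction (torusGraph (d' + 1) N) Finset.univ β h .free :=
    mul_pos (by exact_mod_cast Fintype.card_pos) (isingPartitionFunction_pos _ _ β h _)
  have hre := congrArg Complex.re (hrep k rfl)
  rw [Complex.re_ofReal_mul, Complex.ofReal_re] at hre
  have hu : 0 ≤ 1 - Real.cos (2 * Real.pi * (k 0).val / N) := by
    linarith [Real.cos_le_one (2 * Real.pi * (k 0).val / N)]
  have := hρ0 _ hu
  rw [← hre] at this
  exact nonneg_of_mul_nonneg_right this hpos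

/-- **Monotonicity (i): `Ĝ_N(p)` is decreasing in `|p_i|`** (Aizenman–Duminil-Copin 2021, Prop. 5.4,
first item; Panis 2023, Cor. 3.15 (i); Glimm–Jaffe 1973) — exact finite-volume form on the torus
`(ℤ/Nℤ)^{d'+1}`, `N ≥ 3`, `β ≥ 0`, any field: if `k, k'` agree off the coordinate `i` and
`cos p'_i ≤ cos p_i` (`p = 2πk/N`, i.e. `|p'_i| ≥ |p_i|` on `[-π, π]`), then `Ĝ_N(k') ≤ Ĝ_N(k)`.
[cite: AizenmanDuminilCopinAnnals2021, arXiv:1912.07973 Prop. 5.4 (i) (p. 18)] [cite: Panis2023Triviality, Cor. 3.15 (i)] -/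
theorem twoPointFourierTorus_re_le_of_cos_le (hN : 3 ≤ N) {β : ℝ} (hβ : 0 ≤ β) (h : ℝ) (i : Fin (d' + 1))
    {k k' : TorusSite (d' + 1) N} (hkk' : i.removeNth k' = i.removeNth k)
    (hcos : Real.cos (2 * Real.pi * (k' i).val / N) ≤ Real.cos (2 * Real.pi * (k i).val / N)) :
    (twoPointFourierTorus (isingTorusMeasure (d' + 1) N β h) k').re ≤
      (twoPointFourierTorus (isingTorusMeasure (d' + 1) N β h) k).re := by
  obtain ⟨ρ, -, hanti, -, hrep⟩ := exists_spectralProfile hN hβ h i (i.removeNth k)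
  have hpos : 0 < (Fintype.card (TorusSite d' N) : ℝ) *
      isingPartitionFunction (torusGraph (d' + 1) N) Finset.univ β h .free :=
    mul_pos (by exact_mod_cast Fintype.card_pos) (isingPartitionFunction_pos _ _ β h _)
  have hre := congrArg Complex.re (hrep k rfl)
  have hre' := congrArg Complex.re (hrep k' hkk')
  rw [Complex.re_ofReal_mul, Complex.ofReal_re] at hre hre'
  have hu : 0 ≤ 1 - Real.cos (2 * Real.pi * (k i).val / N) := by
    linarith [Real.cos_le_one (2 * Real.pi * (k i).val / N)]
  have hle := hanti _ _ hu (show 1 - Real.cos (2 * Real.pi * (k i).val / N) ≤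
    1 - Real.cos (2 * Real.pi * (k' i).val / N) by linarith)
  rw [← hre, ← hre'] at hle
  exact le_of_mul_le_mul_left hle hpos

/-- **Monotonicity (ii): `ℰ₁(p_i) Ĝ_N(p)` is increasing in `|p_i|`** (Aizenman–Duminil-Copin 2021,
Prop. 5.4, second item; Panis 2023, Cor. 3.15 (ii)), with `ℰ₁(p_i) = 2(1 - cos p_i)` — exact
finite-volume form on the torus `(ℤ/Nℤ)^{d'+1}`, `N ≥ 3`, `β ≥ 0`, any field: if `k, k'` agree off the
coordinate `i` and `cos p'_i ≤ cos p_i`, then `(1 - cos p_i) Ĝ_N(k) ≤ (1 - cos p'_i) Ĝ_N(k')`.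
[cite: AizenmanDuminilCopinAnnals2021, arXiv:1912.07973 Prop. 5.4 (ii) (p. 18)] [cite: Panis2023Triviality, Cor. 3.15 (ii)] -/
theorem one_sub_cos_mul_twoPointFourierTorus_re_le (hN : 3 ≤ N) {β : ℝ} (hβ : 0 ≤ β) (h : ℝ) (i : Fin (d' + 1))
    {k k' : TorusSite (d' + 1) N} (hkk' : i.removeNth k' = i.removeNth k)
    (hcos : Real.cos (2 * Real.pi * (k' i).val / N) ≤ Real.cos (2 * Real.pi * (k i).val / N)) :
    (1 - Real.cos (2 * Real.pi * (k i).val / N)) * (twoPointFourierTorus (isingTorusMeasure (d' + 1) N β h) k).re ≤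
      (1 - Real.cos (2 * Real.pi * (k' i).val / N)) *
        (twoPointFourierTorus (isingTorusMeasure (d' + 1) N β h) k').re := by
  obtain ⟨ρ, -, -, hmono, hrep⟩ := exists_spectralProfile hN hβ h i (i.removeNth k)
  have hpos : 0 < (Fintype.card (TorusSite d' N) : ℝ) *
      isingPartitionFunction (torusGraph (d' + 1) N) Finset.univ β h .free :=
    mul_pos (by exact_mod_cast Fintype.card_pos) (isingPartitionFunction_pos _ _ β h _)
  have hre := congrArg Complex.re (hrep k rfl)
  have hre' := congrArg Complex.re (hrep k' hkk')
  rw [Complex.re_ofReal_mul, Complex.ofReal_re] at hre hre'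
  have hu : 0 ≤ 1 - Real.cos (2 * Real.pi * (k i).val / N) := by
    linarith [Real.cos_le_one (2 * Real.pi * (k i).val / N)]
  have hle := hmono _ _ hu (show 1 - Real.cos (2 * Real.pi * (k i).val / N) ≤
    1 - Real.cos (2 * Real.pi * (k' i).val / N) by linarith)
  rw [← hre, ← hre'] at hle
  refine le_of_mul_le_mul_left ?_ hpos
  nlinarith [hle]

end Assembly

end Literature.Probability.LatticeModels

end
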